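import Mathlib.RingTheory.MvPolynomial.Ideal
import Mathlib.Order.ModularLattice
import Mathlib.GroupTheory.Perm.Sign
import Literature.Computability.AlgebraicComplexity.LS00TwoByTwoPermanentalIdealsMinimalPrimes
import HarnessLib

/-!
# Laubenbacher–Swanson 2000, Lemma 2.2 and §5: the radical of `P₂(M)` and the primary
# components at its minimal primes

Topic `Literature/Computability/AlgebraicComplexity`; theorem-only file (no definitions, no named
facts), third sibling of `LS00TwoByTwoPermanentalIdeals` (Lemma 2.1, Thm. 4.1 first half, heights)
and `LS00TwoByTwoPermanentalIdealsMinimalPrimes` (Thm. 4.1 second half, Rem. 4.2, Cor. 4.3).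
Source: R. C. Laubenbacher, I. Swanson, *Permanental ideals*, J. Symbolic Comput. 30 (2000)
195–205, arXiv:math/9812112 (held; unnumbered statement heads in the arXiv text — Lemma 2.2 =
p0003 L38–65, Prop. 5.1 = p0007 L11–49, Lemma 5.2 = p0007 L58–96, Lemma 5.3 = p0007 L98–113,
Thm. 5.4 = p0007 L118–186).  `F` a field with `2 ≠ 0` where needed (the paper: characteristic
`≠ 2`), several statements over a commutative ring with `2` a unit or no hypothesis at all;
`P₂(M) = BoraleviCarliniMichalekVentura2025.subpermIdeal F m n 2` is the ideal of the `2 × 2`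
permanents of the generic `m × n` matrix.  The type (1)/(2)/(3) ideals of Thm. 4.1 are written
inline as spans exactly as in the sibling file (`Ideal.span (X '' {x | x.1 ≠ r})`, `… {x | x.2 ≠ c}`,
`Ideal.span (insert per[rs|cd] (X '' off-block))`); the ideals `I₁, I₂, I₃` of §5 are the infima
of these over all rows / columns / blocks, and the printed generating sets are inline spans of
products of variables (no definitions).  The file lands in two parts: v1 = §A–§E, v2 append =
§F (Theorem 5.4) and §G (Proposition 5.1).

## What is typed

* §A `lemma_2_2_sq`, `lemma_2_2` — **Lemma 2.2** ("If `m, n ≥ 3`, `P₂(M)` contains all monomials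
  `x_{i₁j₁}^{e₁} x_{i₂j₂}^{e₂} x_{i₃j₃}^{e₃}` with distinct `i`'s, distinct `j`'s, `eᵢ ≥ 1`,
  `e₁ + e₂ + e₃ = 4`"), `2` a unit, by the printed identity `a y w² = a w (y w + v z) − a w v z` and
  Lemma 2.1 (`lemma_2_1_rows` of the sibling file).
* §B `lemma_5_3_finset`, `lemma_5_3` — **Lemma 5.3 (Niermann [N, p. 103])**:
  `⋂ᵢ (Iᵢ + Jᵢ) = Σᵢ Iᵢ + ⋂ᵢ Jᵢ` whenever `Iᵢ ⊆ Jⱼ` for `i ≠ j`, finite index set; typed for every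
  complete modular lattice ⊇ the ideals of a commutative ring ("a straightforward induction on
  `l`": two applications of the modular law per step).  Mathlib has no such lemma (searched
  `Order/ModularLattice`, `Order/CompleteLattice`).
* §C the alternating `3 × 3` coefficient functional (PROOF DEVIATION, statements as printed): for
  the generic `3 × 3` matrix and EVERY commutative ring, `Σ_{σ ∈ 𝔖₃} sgn(σ) coeff_{m_σ}(f) = 0` for
  all `f ∈ P₂` (`altsum_coeff_eq_zero_of_mem`; `m_σ = x_{0σ0} x_{1σ1} x_{2σ2}`; the involution
  `σ ↦ σ ∘ (a b)` pairs the two monomials of `u · per[ab|uv]` with opposite signs), whence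
  `diag_notMem_three` (`x₀₀x₁₁x₂₂ ∉ P₂`, nontrivial ring), `perm_triple_notMem` (a product of three
  entries of `M` from three distinct rows and three distinct columns is not in `P₂(M)`, any
  `m, n`, any nontrivial commutative ring — kill the other variables and rename), and
  `not_isRadical` (`m, n ≥ 3`, `2` a unit: `P₂(M)` is NOT radical, the direction "only if" of the
  last sentence of Thm. 5.4).  This replaces the paper's single appeal to its §3 Gröbner basis
  (p0007 L183–185: "the monomials `x_{ip}x_{jq}x_{kr}` with distinct `i, j, k` and distinct
  `p, q, r` are not in `P₂(M)`, as can be easily verified via our Gröbner basis in Theorem 3.1");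
  it is characteristic-free and self-contained.
* §D monomial bookkeeping (private): membership in spans of products of two / three distinct
  variables is read off the support (Mathlib `MvPolynomial.mem_ideal_span_monomial_image`).
* §E `lemma_5_2_1`, `lemma_5_2_2`, `lemma_5_2_3` — **Lemma 5.2**: `I₁ = ⟨x_{ij}x_{lk} | i ≠ l⟩`
  (`m ≥ 1`), `I₂ = ⟨x_{ij}x_{lk} | j ≠ k⟩` (`n ≥ 1`), and
  `I₃ = P₂(M) + ⟨x_{ip}x_{jq}x_{kr} | i, j, k distinct⟩ + ⟨x_{ip}x_{jq}x_{kr} | p, q, r distinct⟩`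
  (`m, n ≥ 2`, any commutative ring), the last PROVED as printed by Niermann's lemma over the
  ordered blocks `r < s`, `c < d` with `I_b = (per_b)`, `J_b` = (variables off `b`).
* §F (v2) `radical_eq_inf` (**Thm. 5.4, first equality** `rad P₂ = I₁ ∩ I₂ ∩ I₃`, all
  `m, n ≥ 1`, from `thm_4_1_contains` and the primality of the type ideals),
  `monomial_mem_sup_of_spread` (the monomial step "the latter equality by Lemma 2.1"),
  `thm_5_4` (**Theorem 5.4**: `rad P₂(M) = P₂(M) + ⟨x_{ip}x_{jq}x_{kr} | i,j,k distinct and p,q,r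
  distinct⟩` for all `m, n ≥ 2` — ONE formula for both printed cases, the second summand being `0`
  when `m = 2` or `n = 2`: `span_permTriple_eq_bot`, `thm_5_4_of_two`), and `isRadical_iff`
  (**"So `P₂(M)` is a radical ideal if and only if `m ≤ 2` or `n ≤ 2`"**, all `m, n`; for
  `m ≤ 1` or `n ≤ 1`, `P₂(M) = 0`: `subpermIdeal_two_eq_bot`).
* §G (v2) `prop_5_1` — **Proposition 5.1** ("The primary components of `P₂(M)` corresponding to
  the minimal primes over `P₂(M)` are exactly the minimal primes themselves") in the
  localisation-free form `∀ P ∈ minimalPrimes P₂(M), ∀ x ∈ P, ∃ s ∉ P, s·x ∈ P₂(M)` — this IS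
  "the `P`-primary component `P₂(M)R_P ∩ R` equals `P`" unfolded (LS p0007 L22–24), no
  `Localization` API; proof as printed via Thm. 4.1 and Lemma 2.1.

## What is NOT typed

* §3 (Theorems 3.1–3.3: Gröbner bases, the minimal generators and length of `I/P₂(M)`; the
  Remark on integral closure), Corollary 5.5 (Castelnuovo–Mumford regularity), Corollary 5.6
  ("`P₂(M)` has embedded components iff `m, n ≥ 3`" — needs associated primes / uniqueness of the
  minimal primary components), Theorem 5.7 (the irredundant primary decomposition
  `P₂ = Q ∩ I₁ ∩ I₂ ∩ I₃`, `Q = P₂ + ⟨x_{ij}²⟩`, and its identity `P₂ = Q ∩ rad P₂` — the printed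
  proof uses the Gröbner basis again), Corollary 4.4 (the count of minimal components).

Honest framing: V0 dictionary (commutative algebra of `P₂(M)`, the [LS2000] input of
Boralevi–Carlini–Michałek–Ventura 2025); no rung of any route moves; VP ≠ VNP is NOT proved.

## References

* R. C. Laubenbacher, I. Swanson, *Permanental ideals*, J. Symbolic Comput. 30 (2000) 195–205,
  arXiv:math/9812112: Lemma 2.2 (p0003 L38–65), Prop. 5.1 (p0007 L11–49), Lemma 5.2 (p0007
  L58–96), Lemma 5.3 (p0007 L98–113), Thm. 5.4 (p0007 L118–186). [LaubenbacherSwanson2000]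
* M. Niermann, *Beiträge zur konstruktiven Idealtheorie*, Dissertation, Universität Dortmund
  (1997), p. 103 — Lemma 5.3 as quoted by [LS2000]; not held, cited through [LS2000].
* A. Boralevi, E. Carlini, M. Michałek, E. Ventura, *On the codimension of permanental
  varieties*, Adv. Math. 461 (2025), arXiv:2402.17839 (`subpermIdeal`).
  [BoraleviCarliniMichalekVentura2025]
-/

noncomputable section

open Matrix MvPolynomial Finset

namespace Literature.Computability.AlgebraicComplexity

namespace LaubenbacherSwanson2000

open VonZurGathen BoraleviCarliniMichalekVentura2025

/-! ### §A. Lemma 2.2: the degree-`4` monomials of `P₂(M)` on a `3 × 3` anti-diagonal -/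

section Lemma22

variable {F : Type*} [CommRing F] {m n : ℕ}

/-- **Lemma 2.2, the case `a y w²`** (LS p0003 L56–65: "It suffices to prove that `a y w²` lies in
`P₂(M)`.  But `a y w² = a w (y w + v z) − a w v z`.  As `y w + v z ∈ P₂(M)` by definition and
`a w v z ∈ P₂(M)` by Lemma 2.1, we are done."), for three distinct rows `i, j, k`, three distinct
columns `p, q, r` and `2` a unit: `x_{ip} x_{jq} x_{kr}² ∈ P₂(M)`.
[cite: LaubenbacherSwanson2000, Lemma 2.2 (arXiv text p0003 L38–65)] -/
theorem lemma_2_2_sq (h2 : IsUnit (2 : F)) {i j k : Fin m} {p q r : Fin n} (hik : i ≠ k)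
    (hjk : j ≠ k) (hpq : p ≠ q) (hpr : p ≠ r) (hqr : q ≠ r) :
    (X (i, p) * X (j, q) * X (k, r) ^ 2 : MvPolynomial (Fin m × Fin n) F) ∈
      subpermIdeal F m n 2 := by
  -- `a = x_{ip}`, `y = x_{jq}`, `w = x_{kr}`, `v = x_{kq}`, `z = x_{jr}`
  have e : (X (i, p) * X (j, q) * X (k, r) ^ 2 : MvPolynomial (Fin m × Fin n) F) =
      X (i, p) * X (k, r) * (X (j, q) * X (k, r) + X (j, r) * X (k, q)) -
        X (j, r) * (X (k, q) * X (k, r) * X (i, p)) := by ring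
  rw [e]
  exact Ideal.sub_mem _ (Ideal.mul_mem_left _ _ (pair_mem_subpermIdeal_two F hjk hqr))
    (Ideal.mul_mem_left _ _ (lemma_2_1_rows h2 hik.symm hqr hpq.symm hpr.symm))

/-- **Laubenbacher–Swanson 2000, Lemma 2.2** ("If `m, n ≥ 3`, `P₂(M)` contains all monomials of
the form `x_{i₁j₁}^{e₁} x_{i₂j₂}^{e₂} x_{i₃j₃}^{e₃}` with distinct `i₁, i₂, i₃`, distinct `j₁, j₂, j₃`,
and where `e₁, e₂, e₃` are positive integers which sum to `4`."), for a commutative ring in which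
`2` is a unit (the paper: a field of characteristic `≠ 2`); `m, n ≥ 3` is implied by the
existence of the three distinct rows / columns.
[cite: LaubenbacherSwanson2000, Lemma 2.2 (arXiv text p0003 L38–65)] -/
theorem lemma_2_2 (h2 : IsUnit (2 : F)) {i j k : Fin m} {p q r : Fin n} (hij : i ≠ j)
    (hik : i ≠ k) (hjk : j ≠ k) (hpq : p ≠ q) (hpr : p ≠ r) (hqr : q ≠ r) {e₁ e₂ e₃ : ℕ}
    (he₁ : 0 < e₁) (he₂ : 0 < e₂) (he₃ : 0 < e₃) (hsum : e₁ + e₂ + e₃ = 4) :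
    (X (i, p) ^ e₁ * X (j, q) ^ e₂ * X (k, r) ^ e₃ : MvPolynomial (Fin m × Fin n) F) ∈
      subpermIdeal F m n 2 := by
  -- exactly one exponent is `2`, the other two are `1`
  have hcases : (e₁ = 2 ∧ e₂ = 1 ∧ e₃ = 1) ∨ (e₁ = 1 ∧ e₂ = 2 ∧ e₃ = 1) ∨
      (e₁ = 1 ∧ e₂ = 1 ∧ e₃ = 2) := by omega
  rcases hcases with ⟨rfl, rfl, rfl⟩ | ⟨rfl, rfl, rfl⟩ | ⟨rfl, rfl, rfl⟩
  · have h := lemma_2_2_sq h2 hij.symm hik.symm hqr hpq.symm hpr.symm (F := F)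
    -- `x_{jq} x_{kr} x_{ip}²`
    have e : (X (i, p) ^ 2 * X (j, q) ^ 1 * X (k, r) ^ 1 : MvPolynomial (Fin m × Fin n) F) =
        X (j, q) * X (k, r) * X (i, p) ^ 2 := by ring
    rw [e]; exact h
  · have h := lemma_2_2_sq h2 hij hjk.symm hpr hpq hqr.symm (F := F)
    have e : (X (i, p) ^ 1 * X (j, q) ^ 2 * X (k, r) ^ 1 : MvPolynomial (Fin m × Fin n) F) =
        X (i, p) * X (k, r) * X (j, q) ^ 2 := by ring
    rw [e]; exact h
  · have e : (X (i, p) ^ 1 * X (j, q) ^ 1 * X (k, r) ^ 2 : MvPolynomial (Fin m × Fin n) F) =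
        X (i, p) * X (j, q) * X (k, r) ^ 2 := by ring
    rw [e]; exact lemma_2_2_sq h2 hik hjk hpq hpr hqr

end Lemma22

/-! ### §B. Lemma 5.3 (Niermann): `⋂ (Iᵢ + Jᵢ) = Σ Iᵢ + ⋂ Jᵢ` when `Iᵢ ⊆ Jⱼ` for `i ≠ j` -/

section Niermann

variable {α ι : Type*} [CompleteLattice α] [IsModularLattice α]

/-- **Laubenbacher–Swanson 2000, Lemma 5.3 (Niermann [N, p. 103])** ("Let `R` be an arbitrary
ring and `I₁, …, I_l`, `J₁, …, J_l` ideals in `R` such that `Iᵢ ⊆ Jⱼ` if `i ≠ j`.  Then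
`⋂ᵢ (Iᵢ + Jᵢ) = I₁ + ⋯ + I_l + ⋂ᵢ Jᵢ`.  The proof, given in [N], is a straightforward
induction on `l`."), over a finite index set `s`, typed for any complete modular lattice ⊇ the
lattice of ideals of a commutative ring (the two modular-law steps of the induction are the
whole proof). [cite: LaubenbacherSwanson2000, Lemma 5.3 (arXiv text p0007 L98–112)] -/
theorem lemma_5_3_finset (I J : ι → α) (s : Finset ι)
    (h : ∀ i ∈ s, ∀ j ∈ s, i ≠ j → I i ≤ J j) :
    ⨅ i ∈ s, (I i ⊔ J i) = (⨆ i ∈ s, I i) ⊔ ⨅ i ∈ s, J i := by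
  classical
  induction s using Finset.induction_on with
  | empty => simp
  | insert a s ha ih =>
    have h' : ∀ i ∈ s, ∀ j ∈ s, i ≠ j → I i ≤ J j := fun i hi j hj hij =>
      h i (Finset.mem_insert_of_mem hi) j (Finset.mem_insert_of_mem hj) hij
    have h1 : (⨆ i ∈ s, I i) ≤ J a := iSup₂_le fun i hi =>
      h i (Finset.mem_insert_of_mem hi) a (Finset.mem_insert_self a s) fun e => ha (e ▸ hi)
    have h2 : I a ≤ ⨅ i ∈ s, J i := le_iInf₂ fun i hi =>
      h a (Finset.mem_insert_self a s) i (Finset.mem_insert_of_mem hi) fun e => ha (e ▸ hi)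
    rw [Finset.iInf_insert, Finset.iSup_insert, Finset.iInf_insert, ih h']
    calc (I a ⊔ J a) ⊓ ((⨆ i ∈ s, I i) ⊔ ⨅ i ∈ s, J i)
        = (⨆ i ∈ s, I i) ⊔ (I a ⊔ J a) ⊓ ⨅ i ∈ s, J i := by
          rw [inf_comm, sup_inf_assoc_of_le _ (h1.trans le_sup_right), inf_comm]
      _ = (⨆ i ∈ s, I i) ⊔ (I a ⊔ J a ⊓ ⨅ i ∈ s, J i) := by rw [sup_inf_assoc_of_le _ h2]
      _ = (I a ⊔ ⨆ i ∈ s, I i) ⊔ J a ⊓ ⨅ i ∈ s, J i := by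
          rw [← sup_assoc, sup_comm (⨆ i ∈ s, I i)]

/-- **Lemma 5.3 (Niermann) over a finite index type**: `⨅ᵢ (Iᵢ ⊔ Jᵢ) = (⨆ᵢ Iᵢ) ⊔ ⨅ᵢ Jᵢ` when
`Iᵢ ≤ Jⱼ` for all `i ≠ j`. [cite: LaubenbacherSwanson2000, Lemma 5.3 (arXiv text p0007 L98–112)] -/
theorem lemma_5_3 [Fintype ι] (I J : ι → α) (h : ∀ i j, i ≠ j → I i ≤ J j) :
    ⨅ i, (I i ⊔ J i) = (⨆ i, I i) ⊔ ⨅ i, J i := by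
  have := lemma_5_3_finset I J Finset.univ fun i _ j _ hij => h i j hij
  simpa only [Finset.mem_univ, iInf_pos, iSup_pos, iInf_true, iSup_true] using this

end Niermann

/-! ### §C. The alternating `3 × 3` coefficient functional: `x₁₁ x₂₂ x₃₃ ∉ P₂(M)` -/

section Alternating

variable {R : Type*} [CommRing R]

/-- The exponent `e_{(0,σ0)} + e_{(1,σ1)} + e_{(2,σ2)}` of the permutation monomial of `σ` is the
indicator of the graph of `σ`. [folklore] -/
private theorem graph_apply (σ : Equiv.Perm (Fin 3)) (i j : Fin 3) :
    (Finsupp.single ((0 : Fin 3), σ 0) 1 + Finsupp.single ((1 : Fin 3), σ 1) 1 +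
      Finsupp.single ((2 : Fin 3), σ 2) 1 : Fin 3 × Fin 3 →₀ ℕ) (i, j) =
      if σ i = j then 1 else 0 := by
  simp only [Finsupp.add_apply, Finsupp.single_apply, Prod.mk.injEq]
  fin_cases i <;> simp

/-- An exponent equals the permutation exponent of `σ` iff it is the graph indicator of `σ`.
[folklore] -/
private theorem eq_graph_iff (σ : Equiv.Perm (Fin 3)) (D : Fin 3 × Fin 3 →₀ ℕ) :
    D = Finsupp.single ((0 : Fin 3), σ 0) 1 + Finsupp.single ((1 : Fin 3), σ 1) 1 +
      Finsupp.single ((2 : Fin 3), σ 2) 1 ↔ ∀ i j, D (i, j) = if σ i = j then 1 else 0 := by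
  constructor
  · rintro rfl i j
    exact graph_apply σ i j
  · intro h
    ext ⟨i, j⟩
    rw [h i j, graph_apply]

/-- **The swap**: if `u · x_{au} x_{bv}` (`u` a monomial with exponent `d`, `a ≠ b`) is the
permutation monomial of `σ`, then `u · x_{av} x_{bu}` is the permutation monomial of
`σ ∘ (a b)`. [folklore] -/
private theorem graph_swap {σ : Equiv.Perm (Fin 3)} {a b u v : Fin 3} (hab : a ≠ b)
    {d : Fin 3 × Fin 3 →₀ ℕ}
    (h : d + Finsupp.single (a, u) 1 + Finsupp.single (b, v) 1 =
      Finsupp.single ((0 : Fin 3), σ 0) 1 + Finsupp.single ((1 : Fin 3), σ 1) 1 +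
        Finsupp.single ((2 : Fin 3), σ 2) 1) :
    d + Finsupp.single (a, v) 1 + Finsupp.single (b, u) 1 =
      Finsupp.single ((0 : Fin 3), (σ * Equiv.swap a b) 0) 1 +
        Finsupp.single ((1 : Fin 3), (σ * Equiv.swap a b) 1) 1 +
        Finsupp.single ((2 : Fin 3), (σ * Equiv.swap a b) 2) 1 := by
  rw [eq_graph_iff] at h ⊢
  have H : ∀ i j, d (i, j) + (if a = i ∧ u = j then 1 else 0) +
      (if b = i ∧ v = j then 1 else 0) = if σ i = j then 1 else 0 := by
    intro i j
    have := h i j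
    simpa only [Finsupp.add_apply, Finsupp.single_apply, Prod.mk.injEq] using this
  have hu : σ a = u := by
    by_contra hne
    have := H a u
    rw [if_pos (show a = a ∧ u = u from ⟨rfl, rfl⟩), if_neg hne] at this
    omega
  have hv : σ b = v := by
    by_contra hne
    have := H b v
    rw [if_pos (show b = b ∧ v = v from ⟨rfl, rfl⟩), if_neg hne] at this
    omega
  have hda : ∀ j, d (a, j) = 0 := by
    intro j
    have := H a j
    rw [hu] at this
    by_cases huj : u = j
    · rw [if_pos (show a = a ∧ u = j from ⟨rfl, huj⟩), if_pos huj] at this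
      omega
    · rw [if_neg (show ¬(a = a ∧ u = j) from fun h => huj h.2), if_neg huj] at this
      omega
  have hdb : ∀ j, d (b, j) = 0 := by
    intro j
    have := H b j
    rw [hv] at this
    by_cases hvj : v = j
    · rw [if_pos (show b = b ∧ v = j from ⟨rfl, hvj⟩), if_pos hvj] at this
      omega
    · rw [if_neg (show ¬(b = b ∧ v = j) from fun h => hvj h.2), if_neg hvj] at this
      omega
  intro i j
  by_cases hia : i = a
  · rw [hia, Equiv.Perm.mul_apply, Equiv.swap_apply_left, hv]
    simp only [Finsupp.add_apply, Finsupp.single_apply, Prod.mk.injEq, hda j, zero_add]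
    simp [Ne.symm hab]
  by_cases hib : i = b
  · rw [hib, Equiv.Perm.mul_apply, Equiv.swap_apply_right, hu]
    simp only [Finsupp.add_apply, Finsupp.single_apply, Prod.mk.injEq, hdb j, zero_add]
    simp [hab]
  · rw [Equiv.Perm.mul_apply, Equiv.swap_apply_of_ne_of_ne hia hib]
    have := H i j
    simp only [Finsupp.add_apply, Finsupp.single_apply, Prod.mk.injEq]
    simp only [Ne.symm hia, Ne.symm hib, false_and, if_false, add_zero] at this ⊢
    exact this

/-- **The alternating sum changes sign under the swap**: for `a ≠ b`,
`Σ_σ sgn(σ) [u x_{av} x_{bu} = m_σ] = − Σ_σ sgn(σ) [u x_{au} x_{bv} = m_σ]`. [folklore] -/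
private theorem altsum_swap {a b u v : Fin 3} (hab : a ≠ b) (d : Fin 3 × Fin 3 →₀ ℕ) (c : R) :
    (∑ σ : Equiv.Perm (Fin 3), ((Equiv.Perm.sign σ : ℤ) : R) *
        (if d + Finsupp.single (a, v) 1 + Finsupp.single (b, u) 1 =
          Finsupp.single ((0 : Fin 3), σ 0) 1 + Finsupp.single ((1 : Fin 3), σ 1) 1 +
            Finsupp.single ((2 : Fin 3), σ 2) 1 then c else 0)) =
      -∑ σ : Equiv.Perm (Fin 3), ((Equiv.Perm.sign σ : ℤ) : R) *
        (if d + Finsupp.single (a, u) 1 + Finsupp.single (b, v) 1 =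
          Finsupp.single ((0 : Fin 3), σ 0) 1 + Finsupp.single ((1 : Fin 3), σ 1) 1 +
            Finsupp.single ((2 : Fin 3), σ 2) 1 then c else 0) := by
  rw [← Finset.sum_neg_distrib]
  refine Fintype.sum_equiv (Equiv.mulRight (Equiv.swap a b)) _ _ fun σ => ?_
  simp only [Equiv.coe_mulRight]
  have key : (d + Finsupp.single (a, v) 1 + Finsupp.single (b, u) 1 =
      Finsupp.single ((0 : Fin 3), σ 0) 1 + Finsupp.single ((1 : Fin 3), σ 1) 1 +
        Finsupp.single ((2 : Fin 3), σ 2) 1) ↔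
      (d + Finsupp.single (a, u) 1 + Finsupp.single (b, v) 1 =
        Finsupp.single ((0 : Fin 3), (σ * Equiv.swap a b) 0) 1 +
          Finsupp.single ((1 : Fin 3), (σ * Equiv.swap a b) 1) 1 +
          Finsupp.single ((2 : Fin 3), (σ * Equiv.swap a b) 2) 1) := by
    constructor
    · exact graph_swap hab
    · intro h
      have := graph_swap (σ := σ * Equiv.swap a b) hab h
      simpa only [mul_assoc, Equiv.swap_mul_self, mul_one] using this
  rw [Equiv.Perm.sign_mul, Equiv.Perm.sign_swap hab, Units.val_mul, Units.val_neg,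
    Units.val_one, Int.cast_mul, Int.cast_neg, Int.cast_one]
  by_cases hD : d + Finsupp.single (a, v) 1 + Finsupp.single (b, u) 1 =
      Finsupp.single ((0 : Fin 3), σ 0) 1 + Finsupp.single ((1 : Fin 3), σ 1) 1 +
        Finsupp.single ((2 : Fin 3), σ 2) 1
  · rw [if_pos hD, if_pos (key.1 hD)]
    ring
  · rw [if_neg hD, if_neg (fun h => hD (key.2 h))]
    ring

/-- The alternating sum of the coefficients of the six permutation monomials vanishes on
`u · per[ab|uv]` for every monomial `u` (a coefficient `c` allowed). [folklore] -/
private theorem altsum_monomial_mul_pair {a b u v : Fin 3} (hab : a ≠ b)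
    (d : Fin 3 × Fin 3 →₀ ℕ) (c : R) :
    (∑ σ : Equiv.Perm (Fin 3), ((Equiv.Perm.sign σ : ℤ) : R) *
        coeff (Finsupp.single ((0 : Fin 3), σ 0) 1 + Finsupp.single ((1 : Fin 3), σ 1) 1 +
            Finsupp.single ((2 : Fin 3), σ 2) 1)
          (monomial d c * (X (a, u) * X (b, v) + X (a, v) * X (b, u)))) = 0 := by
  have e : (monomial d c * (X (a, u) * X (b, v) + X (a, v) * X (b, u)) :
      MvPolynomial (Fin 3 × Fin 3) R) =
      monomial (d + Finsupp.single (a, u) 1 + Finsupp.single (b, v) 1) c +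
        monomial (d + Finsupp.single (a, v) 1 + Finsupp.single (b, u) 1) c := by
    simp only [X, monomial_mul, mul_add, mul_one, add_assoc]
  rw [e]
  simp only [coeff_add, coeff_monomial, mul_add, Finset.sum_add_distrib]
  rw [altsum_swap (u := u) (v := v) hab d c, add_neg_cancel]

/-- The alternating sum vanishes on `g · per[ab|uv]` for every polynomial `g`. [folklore] -/
private theorem altsum_mul_pair {a b u v : Fin 3} (hab : a ≠ b)
    (g : MvPolynomial (Fin 3 × Fin 3) R) :
    (∑ σ : Equiv.Perm (Fin 3), ((Equiv.Perm.sign σ : ℤ) : R) *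
        coeff (Finsupp.single ((0 : Fin 3), σ 0) 1 + Finsupp.single ((1 : Fin 3), σ 1) 1 +
            Finsupp.single ((2 : Fin 3), σ 2) 1)
          (g * (X (a, u) * X (b, v) + X (a, v) * X (b, u)))) = 0 := by
  generalize hP : (X (a, u) * X (b, v) + X (a, v) * X (b, u) : MvPolynomial (Fin 3 × Fin 3) R) = P
  induction g using MvPolynomial.induction_on' with
  | monomial d c =>
    subst hP
    exact altsum_monomial_mul_pair hab d c
  | add p q hp hq =>
    simp only [add_mul, coeff_add, mul_add, Finset.sum_add_distrib, hp, hq, add_zero]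

/-- **The alternating functional kills `P₂` of the generic `3 × 3` matrix** (over every
commutative ring): `Σ_{σ ∈ 𝔖₃} sgn(σ) · coeff_{x_{0σ0} x_{1σ1} x_{2σ2}}(f) = 0` for `f ∈ P₂(M)`.
This replaces the paper's appeal to its §3 Gröbner basis (LS, proof of Thm. 5.4: "the monomials … are not
in `P₂(M)`, as can be easily verified via our Gröbner basis") — proof deviation, used for the
printed non-membership statement `perm_triple_notMem`.
[cite: LaubenbacherSwanson2000, proof of Thm. 5.4 (arXiv text p0007 L183–186)] -/
theorem altsum_coeff_eq_zero_of_mem {f : MvPolynomial (Fin 3 × Fin 3) R}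
    (hf : f ∈ subpermIdeal R 3 3 2) :
    (∑ σ : Equiv.Perm (Fin 3), ((Equiv.Perm.sign σ : ℤ) : R) *
        coeff (Finsupp.single ((0 : Fin 3), σ 0) 1 + Finsupp.single ((1 : Fin 3), σ 1) 1 +
          Finsupp.single ((2 : Fin 3), σ 2) 1) f) = 0 := by
  classical
  suffices H : ∀ f ∈ subpermIdeal R 3 3 2, ∀ g : MvPolynomial (Fin 3 × Fin 3) R,
      (∑ σ : Equiv.Perm (Fin 3), ((Equiv.Perm.sign σ : ℤ) : R) *
        coeff (Finsupp.single ((0 : Fin 3), σ 0) 1 + Finsupp.single ((1 : Fin 3), σ 1) 1 +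
          Finsupp.single ((2 : Fin 3), σ 2) 1) (g * f)) = 0 by
    simpa only [one_mul] using H f hf 1
  intro f hf
  refine Submodule.span_induction ?_ ?_ ?_ ?_ hf
  · rintro f ⟨Rw, Cl, hR, hC, rfl⟩ g
    obtain ⟨a, b, hab, rfl⟩ := Finset.card_eq_two.1 hR
    obtain ⟨u, v, huv, rfl⟩ := Finset.card_eq_two.1 hC
    rw [rsubperm_pair _ hab huv]
    simp only [Matrix.mvPolynomialX_apply]
    exact altsum_mul_pair hab g
  · intro g
    simp
  · intro x y _ _ hx hy g
    simp only [mul_add, coeff_add, Finset.sum_add_distrib, hx g, hy g, add_zero]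
  · intro r x _ hx g
    simpa only [smul_eq_mul, ← mul_assoc] using hx (g * r)

/-- **`x₀₀ x₁₁ x₂₂ ∉ P₂` for the generic `3 × 3` matrix over every nontrivial commutative ring**
(LS, proof of Thm. 5.4: "the monomials of the form `x_{ip} x_{jq} x_{kr}` with distinct `i, j, k`
and distinct `p, q, r` are not in `P₂(M)`, as can be easily verified via our Gröbner basis";
here: the alternating functional takes the value `1` on this monomial).
[cite: LaubenbacherSwanson2000, proof of Thm. 5.4 (arXiv text p0007 L183–186)] -/
theorem diag_notMem_three [Nontrivial R] :
    (X ((0 : Fin 3), (0 : Fin 3)) * X ((1 : Fin 3), (1 : Fin 3)) * X ((2 : Fin 3), (2 : Fin 3)) :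
      MvPolynomial (Fin 3 × Fin 3) R) ∉ subpermIdeal R 3 3 2 := by
  classical
  intro hmem
  have h0 := altsum_coeff_eq_zero_of_mem hmem
  have e : (X ((0 : Fin 3), (0 : Fin 3)) * X ((1 : Fin 3), (1 : Fin 3)) *
      X ((2 : Fin 3), (2 : Fin 3)) : MvPolynomial (Fin 3 × Fin 3) R) =
      monomial (Finsupp.single ((0 : Fin 3), (1 : Equiv.Perm (Fin 3)) 0) 1 +
        Finsupp.single ((1 : Fin 3), (1 : Equiv.Perm (Fin 3)) 1) 1 +
        Finsupp.single ((2 : Fin 3), (1 : Equiv.Perm (Fin 3)) 2) 1) 1 := by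
    simp only [X, monomial_mul, mul_one, Equiv.Perm.one_apply]
  rw [e] at h0
  simp only [coeff_monomial] at h0
  have key : ∀ σ : Equiv.Perm (Fin 3),
      (Finsupp.single ((0 : Fin 3), (1 : Equiv.Perm (Fin 3)) 0) 1 +
          Finsupp.single ((1 : Fin 3), (1 : Equiv.Perm (Fin 3)) 1) 1 +
          Finsupp.single ((2 : Fin 3), (1 : Equiv.Perm (Fin 3)) 2) 1 =
        Finsupp.single ((0 : Fin 3), σ 0) 1 + Finsupp.single ((1 : Fin 3), σ 1) 1 +
          Finsupp.single ((2 : Fin 3), σ 2) 1) ↔ 1 = σ := by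
    intro σ
    constructor
    · intro h
      rw [eq_graph_iff] at h
      refine Equiv.ext fun i => ?_
      have := h i i
      rw [graph_apply, Equiv.Perm.one_apply, if_pos rfl] at this
      rw [Equiv.Perm.one_apply]
      by_contra hne
      rw [if_neg (fun e => hne e.symm)] at this
      exact one_ne_zero this
    · rintro rfl
      rfl
  simp_rw [key] at h0
  simp only [mul_ite, mul_one, mul_zero, Finset.sum_ite_eq, Finset.mem_univ, if_true,
    Equiv.Perm.sign_one, Units.val_one, Int.cast_one] at h0
  exact one_ne_zero h0

/-- `P₂(M) ≤ J` as soon as `J` contains every written-out `2 × 2` permanent (the generators), over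
a commutative ring (the sibling file's `subpermIdeal_two_le_of_pairs` is stated for fields).
[cite: LaubenbacherSwanson2000, §1 (definition of `P_r(M)`, arXiv text p0002 L36–41)] -/
private theorem subpermIdeal_two_le_of_pairs' {m n : ℕ} (J : Ideal (MvPolynomial (Fin m × Fin n) R))
    (h : ∀ (r s : Fin m) (i j : Fin n), r ≠ s → i ≠ j →
      (X (r, i) * X (s, j) + X (r, j) * X (s, i) : MvPolynomial (Fin m × Fin n) R) ∈ J) :
    subpermIdeal R m n 2 ≤ J := by
  classical
  refine subpermIdeal_le_iff.2 fun Rw Cl hR hC => ?_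
  obtain ⟨r, s, hrs, rfl⟩ := Finset.card_eq_two.1 hR
  obtain ⟨i, j, hij, rfl⟩ := Finset.card_eq_two.1 hC
  rw [rsubperm_pair _ hrs hij]
  simpa only [Matrix.mvPolynomialX_apply] using h r s i j hrs hij

/-- **A product of three entries from three distinct rows and three distinct columns is not in
`P₂(M)`**, over every nontrivial commutative ring (LS, proof of Thm. 5.4, p0007 L183–186, "as
can be easily verified via our Gröbner basis" — here: kill the variables off the three rows and
columns and apply the `3 × 3` alternating functional).
[cite: LaubenbacherSwanson2000, proof of Thm. 5.4 (arXiv text p0007 L183–186)] -/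
theorem perm_triple_notMem [Nontrivial R] {m n : ℕ} {i j k : Fin m} {p q r : Fin n}
    (hij : i ≠ j) (hik : i ≠ k) (hjk : j ≠ k) (hpq : p ≠ q) (hpr : p ≠ r) (hqr : q ≠ r) :
    (X (i, p) * X (j, q) * X (k, r) : MvPolynomial (Fin m × Fin n) R) ∉ subpermIdeal R m n 2 := by
  classical
  intro hmem
  -- rows and columns of the triple
  let ρ : Fin 3 → Fin m := ![i, j, k]
  let κ : Fin 3 → Fin n := ![p, q, r]
  have hρ : Function.Injective ρ := by
    intro s t h
    fin_cases s <;> fin_cases t <;> simp_all [ρ]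
  have hκ : Function.Injective κ := by
    intro s t h
    fin_cases s <;> fin_cases t <;> simp_all [κ]
  -- kill the variables off `ρ(Fin 3) × κ(Fin 3)` and rename the others to the `3 × 3` matrix
  let φ : MvPolynomial (Fin m × Fin n) R →ₐ[R] MvPolynomial (Fin 3 × Fin 3) R :=
    aeval fun x => if x.1 ∈ Set.range ρ ∧ x.2 ∈ Set.range κ then
      X (Function.invFun ρ x.1, Function.invFun κ x.2) else 0
  have hφ_in : ∀ s t, φ (X (ρ s, κ t)) = X (s, t) := by
    intro s t
    simp only [φ, aeval_X]
    rw [if_pos ⟨⟨s, rfl⟩, ⟨t, rfl⟩⟩, Function.leftInverse_invFun hρ s,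
      Function.leftInverse_invFun hκ t]
  have hφ_row : ∀ x : Fin m × Fin n, x.1 ∉ Set.range ρ → φ (X x) = 0 := by
    intro x hx
    simp only [φ, aeval_X]
    rw [if_neg (fun h => hx h.1)]
  have hφ_col : ∀ x : Fin m × Fin n, x.2 ∉ Set.range κ → φ (X x) = 0 := by
    intro x hx
    simp only [φ, aeval_X]
    rw [if_neg (fun h => hx h.2)]
  -- `φ(P₂(M)) ⊆ P₂` of the `3 × 3` matrix
  have hmap : (subpermIdeal R m n 2).map φ ≤ subpermIdeal R 3 3 2 := by
    rw [Ideal.map_le_iff_le_comap]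
    refine subpermIdeal_two_le_of_pairs' _ fun a b c d hab hcd => ?_
    rw [Ideal.mem_comap, map_add, map_mul, map_mul]
    by_cases ha : a ∈ Set.range ρ
    swap
    · rw [hφ_row (a, c) ha, hφ_row (a, d) ha, zero_mul, zero_mul, add_zero]
      exact Ideal.zero_mem _
    by_cases hb : b ∈ Set.range ρ
    swap
    · rw [hφ_row (b, c) hb, hφ_row (b, d) hb, mul_zero, mul_zero, add_zero]
      exact Ideal.zero_mem _
    by_cases hc : c ∈ Set.range κ
    swap
    · rw [hφ_col (a, c) hc, hφ_col (b, c) hc, zero_mul, mul_zero, add_zero]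
      exact Ideal.zero_mem _
    by_cases hd : d ∈ Set.range κ
    swap
    · rw [hφ_col (b, d) hd, hφ_col (a, d) hd, mul_zero, zero_mul, add_zero]
      exact Ideal.zero_mem _
    obtain ⟨sa, rfl⟩ := ha
    obtain ⟨sb, rfl⟩ := hb
    obtain ⟨tc, rfl⟩ := hc
    obtain ⟨td, rfl⟩ := hd
    rw [hφ_in, hφ_in, hφ_in, hφ_in]
    exact pair_mem_subpermIdeal_two R (fun h => hab (congrArg ρ h)) (fun h => hcd (congrArg κ h))
  have himg : φ (X (i, p) * X (j, q) * X (k, r)) ∈ subpermIdeal R 3 3 2 :=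
    hmap (Ideal.mem_map_of_mem φ hmem)
  have e : φ (X (i, p) * X (j, q) * X (k, r)) =
      X ((0 : Fin 3), (0 : Fin 3)) * X ((1 : Fin 3), (1 : Fin 3)) * X ((2 : Fin 3), (2 : Fin 3)) := by
    rw [map_mul, map_mul, show ((i, p) : Fin m × Fin n) = (ρ 0, κ 0) from rfl,
      show ((j, q) : Fin m × Fin n) = (ρ 1, κ 1) from rfl,
      show ((k, r) : Fin m × Fin n) = (ρ 2, κ 2) from rfl, hφ_in, hφ_in, hφ_in]
  rw [e] at himg
  exact diag_notMem_three himg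

/-- **`P₂(M)` is not a radical ideal for `m, n ≥ 3`** (LS Thm. 5.4, last sentence, direction
"only if"; over every nontrivial commutative ring in which `2` is a unit): `x₁₁ x₂₂ x₃₃` lies in
the radical by Lemma 2.2 (`(x₁₁x₂₂x₃₃)² = x₁₁x₂₂ · x₁₁x₂₂x₃₃²`) but not in `P₂(M)`.
[cite: LaubenbacherSwanson2000, Thm. 5.4 (arXiv text p0007 L118–133, proof L183–186)] -/
theorem not_isRadical [Nontrivial R] (h2 : IsUnit (2 : R)) {m n : ℕ} (hm : 3 ≤ m) (hn : 3 ≤ n) :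
    ¬(subpermIdeal R m n 2).IsRadical := by
  intro hrad
  have h01 : (⟨0, by omega⟩ : Fin m) ≠ ⟨1, by omega⟩ := fun h => by simp at h
  have h02 : (⟨0, by omega⟩ : Fin m) ≠ ⟨2, by omega⟩ := fun h => by simp at h
  have h12 : (⟨1, by omega⟩ : Fin m) ≠ ⟨2, by omega⟩ := fun h => by simp at h
  have h01' : (⟨0, by omega⟩ : Fin n) ≠ ⟨1, by omega⟩ := fun h => by simp at h
  have h02' : (⟨0, by omega⟩ : Fin n) ≠ ⟨2, by omega⟩ := fun h => by simp at h
  have h12' : (⟨1, by omega⟩ : Fin n) ≠ ⟨2, by omega⟩ := fun h => by simp at h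
  have hsq := lemma_2_2_sq h2 h02 h12 h01' h02' h12' (F := R)
  have hmem : (X ((⟨0, by omega⟩ : Fin m), (⟨0, by omega⟩ : Fin n)) *
      X ((⟨1, by omega⟩ : Fin m), (⟨1, by omega⟩ : Fin n)) *
      X ((⟨2, by omega⟩ : Fin m), (⟨2, by omega⟩ : Fin n)) : MvPolynomial (Fin m × Fin n) R) ^ 2 ∈
      subpermIdeal R m n 2 := by
    have e : (X ((⟨0, by omega⟩ : Fin m), (⟨0, by omega⟩ : Fin n)) *
        X ((⟨1, by omega⟩ : Fin m), (⟨1, by omega⟩ : Fin n)) *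
        X ((⟨2, by omega⟩ : Fin m), (⟨2, by omega⟩ : Fin n)) : MvPolynomial (Fin m × Fin n) R) ^ 2 =
        X ((⟨0, by omega⟩ : Fin m), (⟨0, by omega⟩ : Fin n)) *
          X ((⟨1, by omega⟩ : Fin m), (⟨1, by omega⟩ : Fin n)) *
          (X ((⟨0, by omega⟩ : Fin m), (⟨0, by omega⟩ : Fin n)) *
            X ((⟨1, by omega⟩ : Fin m), (⟨1, by omega⟩ : Fin n)) *
            X ((⟨2, by omega⟩ : Fin m), (⟨2, by omega⟩ : Fin n)) ^ 2) := by ring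
    rw [e]
    exact Ideal.mul_mem_left _ _ hsq
  exact perm_triple_notMem h01 h02 h12 h01' h02' h12' (hrad ⟨2, hmem⟩)

end Alternating

/-! ### §D. Monomial bookkeeping: spans of products of variables -/

section MonomialIdeals

variable {F : Type*} [CommRing F] {σ : Type*}

/-- The set of products `X a * X b` (`P a b`) is the set of monic monomials on the exponents
`e_a + e_b`. [folklore] -/
private theorem setOf_pairMul_eq_image (P : σ → σ → Prop) :
    {f : MvPolynomial σ F | ∃ a b, P a b ∧ f = X a * X b} =
      (fun s => monomial s (1 : F)) ''
        {s | ∃ a b, P a b ∧ s = Finsupp.single a 1 + Finsupp.single b 1} := by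
  ext f
  constructor
  · rintro ⟨a, b, h, rfl⟩
    exact ⟨_, ⟨a, b, h, rfl⟩, by simp [X, monomial_mul]⟩
  · rintro ⟨s, ⟨a, b, h, rfl⟩, rfl⟩
    exact ⟨a, b, h, by simp [X, monomial_mul]⟩

/-- The set of products `X a * X b * X c` (`P a b c`) is the set of monic monomials on the
exponents `e_a + e_b + e_c`. [folklore] -/
private theorem setOf_tripleMul_eq_image (P : σ → σ → σ → Prop) :
    {f : MvPolynomial σ F | ∃ a b c, P a b c ∧ f = X a * X b * X c} =
      (fun s => monomial s (1 : F)) ''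
        {s | ∃ a b c, P a b c ∧
          s = Finsupp.single a 1 + Finsupp.single b 1 + Finsupp.single c 1} := by
  ext f
  constructor
  · rintro ⟨a, b, c, h, rfl⟩
    exact ⟨_, ⟨a, b, c, h, rfl⟩, by simp [X, monomial_mul]⟩
  · rintro ⟨s, ⟨a, b, c, h, rfl⟩, rfl⟩
    exact ⟨a, b, c, h, by simp [X, monomial_mul]⟩

/-- `x_a x_b ∣ x^u` iff `a, b ∈ supp u` (`a ≠ b`). [folklore] -/
private theorem single_add_single_le_iff {a b : σ} (hab : a ≠ b) (u : σ →₀ ℕ) :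
    Finsupp.single a 1 + Finsupp.single b 1 ≤ u ↔ u a ≠ 0 ∧ u b ≠ 0 := by
  classical
  constructor
  · intro h
    have ha := h a
    have hb := h b
    rw [Finsupp.add_apply, Finsupp.single_eq_same, Finsupp.single_eq_of_ne hab] at ha
    rw [Finsupp.add_apply, Finsupp.single_eq_of_ne hab.symm, Finsupp.single_eq_same] at hb
    omega
  · rintro ⟨ha, hb⟩ x
    simp only [Finsupp.add_apply, Finsupp.single_apply]
    by_cases hxa : a = x
    · have hxb : ¬b = x := fun h => hab (hxa.trans h.symm)
      rw [if_pos hxa, if_neg hxb, ← hxa]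
      omega
    · by_cases hxb : b = x
      · rw [if_neg hxa, if_pos hxb, ← hxb]
        omega
      · rw [if_neg hxa, if_neg hxb]
        omega

/-- `x_a x_b x_c ∣ x^u` iff `a, b, c ∈ supp u` (`a, b, c` pairwise distinct). [folklore] -/
private theorem single_add_single_add_single_le_iff {a b c : σ} (hab : a ≠ b) (hac : a ≠ c)
    (hbc : b ≠ c) (u : σ →₀ ℕ) :
    Finsupp.single a 1 + Finsupp.single b 1 + Finsupp.single c 1 ≤ u ↔
      u a ≠ 0 ∧ u b ≠ 0 ∧ u c ≠ 0 := by
  classical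
  constructor
  · intro h
    have ha := h a
    have hb := h b
    have hc := h c
    rw [Finsupp.add_apply, Finsupp.add_apply, Finsupp.single_eq_same,
      Finsupp.single_eq_of_ne hab, Finsupp.single_eq_of_ne hac] at ha
    rw [Finsupp.add_apply, Finsupp.add_apply, Finsupp.single_eq_of_ne hab.symm,
      Finsupp.single_eq_same, Finsupp.single_eq_of_ne hbc] at hb
    rw [Finsupp.add_apply, Finsupp.add_apply, Finsupp.single_eq_of_ne hac.symm,
      Finsupp.single_eq_of_ne hbc.symm, Finsupp.single_eq_same] at hc
    omega
  · rintro ⟨ha, hb, hc⟩ x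
    simp only [Finsupp.add_apply, Finsupp.single_apply]
    by_cases hxa : a = x
    · rw [if_pos hxa, if_neg (fun h => hab (hxa.trans h.symm)),
        if_neg (fun h => hac (hxa.trans h.symm)), ← hxa]
      omega
    by_cases hxb : b = x
    · rw [if_neg hxa, if_pos hxb, if_neg (fun h => hbc (hxb.trans h.symm)), ← hxb]
      omega
    by_cases hxc : c = x
    · rw [if_neg hxa, if_neg hxb, if_pos hxc, ← hxc]
      omega
    · rw [if_neg hxa, if_neg hxb, if_neg hxc]
      omega

/-- **Membership in a span of products of two variables is read off the support.** [folklore] -/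
private theorem mem_span_pairMul_iff (P : σ → σ → Prop) (hP : ∀ a b, P a b → a ≠ b)
    (f : MvPolynomial σ F) :
    f ∈ Ideal.span {f : MvPolynomial σ F | ∃ a b, P a b ∧ f = X a * X b} ↔
      ∀ u ∈ f.support, ∃ a b, P a b ∧ u a ≠ 0 ∧ u b ≠ 0 := by
  rw [setOf_pairMul_eq_image, mem_ideal_span_monomial_image]
  refine forall₂_congr fun u _ => ⟨?_, ?_⟩
  · rintro ⟨s, ⟨a, b, h, rfl⟩, hle⟩
    exact ⟨a, b, h, (single_add_single_le_iff (hP a b h) u).1 hle⟩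
  · rintro ⟨a, b, h, hu⟩
    exact ⟨_, ⟨a, b, h, rfl⟩, (single_add_single_le_iff (hP a b h) u).2 hu⟩

/-- **Membership in a span of products of three distinct variables is read off the support.**
[folklore] -/
private theorem mem_span_tripleMul_iff (P : σ → σ → σ → Prop)
    (hP : ∀ a b c, P a b c → a ≠ b ∧ a ≠ c ∧ b ≠ c) (f : MvPolynomial σ F) :
    f ∈ Ideal.span {f : MvPolynomial σ F | ∃ a b c, P a b c ∧ f = X a * X b * X c} ↔
      ∀ u ∈ f.support, ∃ a b c, P a b c ∧ u a ≠ 0 ∧ u b ≠ 0 ∧ u c ≠ 0 := by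
  rw [setOf_tripleMul_eq_image, mem_ideal_span_monomial_image]
  refine forall₂_congr fun u _ => ⟨?_, ?_⟩
  · rintro ⟨s, ⟨a, b, c, h, rfl⟩, hle⟩
    obtain ⟨h1, h2, h3⟩ := hP a b c h
    exact ⟨a, b, c, h, (single_add_single_add_single_le_iff h1 h2 h3 u).1 hle⟩
  · rintro ⟨a, b, c, h, hu⟩
    obtain ⟨h1, h2, h3⟩ := hP a b c h
    exact ⟨_, ⟨a, b, c, h, rfl⟩, (single_add_single_add_single_le_iff h1 h2 h3 u).2 hu⟩

/-- An ideal contains `f` as soon as it contains the monic monomial of every exponent in the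
support of `f`. [folklore] -/
private theorem mem_ideal_of_monomial_mem {I : Ideal (MvPolynomial σ F)} {f : MvPolynomial σ F}
    (h : ∀ u ∈ f.support, monomial u (1 : F) ∈ I) : f ∈ I := by
  rw [f.as_sum]
  refine Ideal.sum_mem _ fun u hu => ?_
  rw [← mul_one (coeff u f), ← C_mul_monomial]
  exact Ideal.mul_mem_left _ _ (h u hu)

/-- If three distinct points `a, b, c` of the support of `u` have `x_a x_b x_c ∈ I`, then
`x^u ∈ I`. [folklore] -/
private theorem monomial_mem_of_triple_mem {I : Ideal (MvPolynomial σ F)} {u : σ →₀ ℕ}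
    {a b c : σ} (hab : a ≠ b) (hac : a ≠ c) (hbc : b ≠ c) (ha : u a ≠ 0) (hb : u b ≠ 0)
    (hc : u c ≠ 0) (h : (X a * X b * X c : MvPolynomial σ F) ∈ I) :
    monomial u (1 : F) ∈ I := by
  have hle : Finsupp.single a 1 + Finsupp.single b 1 + Finsupp.single c 1 ≤ u :=
    (single_add_single_add_single_le_iff hab hac hbc u).2 ⟨ha, hb, hc⟩
  obtain ⟨w, hw⟩ := exists_add_of_le hle
  have e : (monomial u (1 : F) : MvPolynomial σ F) = monomial w 1 * (X a * X b * X c) := by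
    rw [hw, add_comm]
    simp [X, monomial_mul]
  rw [e]
  exact Ideal.mul_mem_left _ _ h

end MonomialIdeals

/-! ### §E. Lemma 5.2: the unmixed parts `I₁`, `I₂`, `I₃` -/

section Lemma52

variable (F : Type*) [CommRing F] {m n : ℕ}

/-- **Laubenbacher–Swanson 2000, Lemma 5.2 (1)** ("`I₁ = ⟨x_{ij} x_{lk} | i ≠ l⟩`", where
`I₁ = ⋂_{P ∈ 𝒫₁} P` is the intersection of the type (1) primes — the ideals of the variables off
one row), typed for `m ≥ 1` ⊇ printed `m, n ≥ 2`, `n ≥ 3` (both sides are read off supports: a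
monomial lies in every "variables off row `r`" ideal iff it involves two distinct rows).
[cite: LaubenbacherSwanson2000, Lemma 5.2 (1) (arXiv text p0007 L58–88)] -/
theorem lemma_5_2_1 (hm : 1 ≤ m) :
    ⨅ r : Fin m, Ideal.span ((fun x => (X x : MvPolynomial (Fin m × Fin n) F)) '' {x | x.1 ≠ r}) =
      Ideal.span {f : MvPolynomial (Fin m × Fin n) F |
        ∃ a b : Fin m × Fin n, a.1 ≠ b.1 ∧ f = X a * X b} := by
  apply le_antisymm
  · intro f hf
    rw [Submodule.mem_iInf] at hf
    rw [mem_span_pairMul_iff _ (fun a b h e => h (congrArg Prod.fst e))]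
    intro u hu
    obtain ⟨x, -, hx⟩ := mem_ideal_span_X_image.1 (hf ⟨0, by omega⟩) u hu
    obtain ⟨y, hy, huy⟩ := mem_ideal_span_X_image.1 (hf x.1) u hu
    exact ⟨y, x, hy, huy, hx⟩
  · rw [Ideal.span_le]
    rintro f ⟨a, b, hab, rfl⟩
    rw [SetLike.mem_coe, Submodule.mem_iInf]
    intro r
    by_cases ha : a.1 = r
    · have hb : b.1 ≠ r := fun h => hab (ha.trans h.symm)
      exact Ideal.mul_mem_left _ _ (Ideal.subset_span ⟨b, hb, rfl⟩)
    · exact Ideal.mul_mem_right _ _ (Ideal.subset_span ⟨a, ha, rfl⟩)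

/-- **Laubenbacher–Swanson 2000, Lemma 5.2 (2)** ("`I₂ = ⟨x_{ij} x_{lk} | j ≠ k⟩`", the intersection
of the type (2) primes — the ideals of the variables off one column), typed for `n ≥ 1`.
[cite: LaubenbacherSwanson2000, Lemma 5.2 (2) (arXiv text p0007 L58–90)] -/
theorem lemma_5_2_2 (hn : 1 ≤ n) :
    ⨅ c : Fin n, Ideal.span ((fun x => (X x : MvPolynomial (Fin m × Fin n) F)) '' {x | x.2 ≠ c}) =
      Ideal.span {f : MvPolynomial (Fin m × Fin n) F |
        ∃ a b : Fin m × Fin n, a.2 ≠ b.2 ∧ f = X a * X b} := by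
  apply le_antisymm
  · intro f hf
    rw [Submodule.mem_iInf] at hf
    rw [mem_span_pairMul_iff _ (fun a b h e => h (congrArg Prod.snd e))]
    intro u hu
    obtain ⟨x, -, hx⟩ := mem_ideal_span_X_image.1 (hf ⟨0, by omega⟩) u hu
    obtain ⟨y, hy, huy⟩ := mem_ideal_span_X_image.1 (hf x.2) u hu
    exact ⟨y, x, hy, huy, hx⟩
  · rw [Ideal.span_le]
    rintro f ⟨a, b, hab, rfl⟩
    rw [SetLike.mem_coe, Submodule.mem_iInf]
    intro c
    by_cases ha : a.2 = c
    · have hb : b.2 ≠ c := fun h => hab (ha.trans h.symm)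
      exact Ideal.mul_mem_left _ _ (Ideal.subset_span ⟨b, hb, rfl⟩)
    · exact Ideal.mul_mem_right _ _ (Ideal.subset_span ⟨a, ha, rfl⟩)

/-- Two rows cover a set of at most two rows (`m ≥ 2`). [folklore] -/
private theorem exists_lt_pair_cover (hm : 2 ≤ m) (S : Finset (Fin m)) (hS : S.card ≤ 2) :
    ∃ r s : Fin m, r < s ∧ ∀ a ∈ S, a = r ∨ a = s := by
  have h01 : (⟨0, by omega⟩ : Fin m) < ⟨1, by omega⟩ := Fin.mk_lt_mk.2 (by omega)
  rcases Nat.lt_or_ge S.card 1 with h0 | h1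
  · rw [Nat.lt_one_iff, Finset.card_eq_zero] at h0
    exact ⟨_, _, h01, fun a ha => by simp [h0] at ha⟩
  rcases Nat.lt_or_ge S.card 2 with h1' | h2
  · obtain ⟨a, rfl⟩ := Finset.card_eq_one.1 (show S.card = 1 by omega)
    by_cases ha : a.val = 0
    · refine ⟨a, ⟨1, by omega⟩, Fin.lt_def.2 (show a.val < 1 by omega),
        fun b hb => ?_⟩
      exact Or.inl (Finset.mem_singleton.1 hb)
    · refine ⟨⟨0, by omega⟩, a, Fin.lt_def.2 (show 0 < a.val by omega),
        fun b hb => ?_⟩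
      exact Or.inr (Finset.mem_singleton.1 hb)
  · obtain ⟨a, b, hab, rfl⟩ := Finset.card_eq_two.1 (show S.card = 2 by omega)
    rcases lt_or_gt_of_ne hab with h | h
    · exact ⟨a, b, h, fun x hx => by simpa using hx⟩
    · exact ⟨b, a, h, fun x hx => by simpa [or_comm] using hx⟩

/-- If no three support points of `u` lie in pairwise distinct rows, the support rows are covered
by two rows `r < s` (`m ≥ 2`). [folklore] -/
private theorem exists_rows_cover (hm : 2 ≤ m) (u : Fin m × Fin n →₀ ℕ)
    (h : ¬∃ a b c : Fin m × Fin n, (a.1 ≠ b.1 ∧ a.1 ≠ c.1 ∧ b.1 ≠ c.1) ∧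
      u a ≠ 0 ∧ u b ≠ 0 ∧ u c ≠ 0) :
    ∃ r s : Fin m, r < s ∧ ∀ x, u x ≠ 0 → x.1 = r ∨ x.1 = s := by
  classical
  have hcard : (u.support.image Prod.fst).card ≤ 2 := by
    by_contra hlt
    obtain ⟨r₁, h₁, r₂, h₂, r₃, h₃, h12, h13, h23⟩ :=
      Finset.two_lt_card.1 (show 2 < (u.support.image Prod.fst).card by omega)
    obtain ⟨a, ha, rfl⟩ := Finset.mem_image.1 h₁
    obtain ⟨b, hb, rfl⟩ := Finset.mem_image.1 h₂
    obtain ⟨c, hc, rfl⟩ := Finset.mem_image.1 h₃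
    exact h ⟨a, b, c, ⟨h12, h13, h23⟩, Finsupp.mem_support_iff.1 ha,
      Finsupp.mem_support_iff.1 hb, Finsupp.mem_support_iff.1 hc⟩
  obtain ⟨r, s, hrs, hcov⟩ := exists_lt_pair_cover hm _ hcard
  exact ⟨r, s, hrs, fun x hx => hcov x.1
    (Finset.mem_image.2 ⟨x, Finsupp.mem_support_iff.2 hx, rfl⟩)⟩

/-- Column version of `exists_rows_cover`. [folklore] -/
private theorem exists_cols_cover (hn : 2 ≤ n) (u : Fin m × Fin n →₀ ℕ)
    (h : ¬∃ a b c : Fin m × Fin n, (a.2 ≠ b.2 ∧ a.2 ≠ c.2 ∧ b.2 ≠ c.2) ∧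
      u a ≠ 0 ∧ u b ≠ 0 ∧ u c ≠ 0) :
    ∃ c d : Fin n, c < d ∧ ∀ x, u x ≠ 0 → x.2 = c ∨ x.2 = d := by
  classical
  have hcard : (u.support.image Prod.snd).card ≤ 2 := by
    by_contra hlt
    obtain ⟨r₁, h₁, r₂, h₂, r₃, h₃, h12, h13, h23⟩ :=
      Finset.two_lt_card.1 (show 2 < (u.support.image Prod.snd).card by omega)
    obtain ⟨a, ha, rfl⟩ := Finset.mem_image.1 h₁
    obtain ⟨b, hb, rfl⟩ := Finset.mem_image.1 h₂
    obtain ⟨c, hc, rfl⟩ := Finset.mem_image.1 h₃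
    exact h ⟨a, b, c, ⟨h12, h13, h23⟩, Finsupp.mem_support_iff.1 ha,
      Finsupp.mem_support_iff.1 hb, Finsupp.mem_support_iff.1 hc⟩
  obtain ⟨c, d, hcd, hcov⟩ := exists_lt_pair_cover hn _ hcard
  exact ⟨c, d, hcd, fun x hx => hcov x.2
    (Finset.mem_image.2 ⟨x, Finsupp.mem_support_iff.2 hx, rfl⟩)⟩

/-- The type (3) ideal does not depend on the order of its two rows. [folklore] -/
private theorem blockIdeal_swap_rows (r s : Fin m) (c d : Fin n) :
    Ideal.span (insert (X (r, c) * X (s, d) + X (r, d) * X (s, c) :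
        MvPolynomial (Fin m × Fin n) F)
      ((fun x => (X x : MvPolynomial (Fin m × Fin n) F)) ''
        {x | ¬((x.1 = r ∨ x.1 = s) ∧ (x.2 = c ∨ x.2 = d))})) =
    Ideal.span (insert (X (s, c) * X (r, d) + X (s, d) * X (r, c) :
        MvPolynomial (Fin m × Fin n) F)
      ((fun x => (X x : MvPolynomial (Fin m × Fin n) F)) ''
        {x | ¬((x.1 = s ∨ x.1 = r) ∧ (x.2 = c ∨ x.2 = d))})) := by
  congr 2
  · ring
  · ext x
    simp only [or_comm]

/-- The type (3) ideal does not depend on the order of its two columns. [folklore] -/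
private theorem blockIdeal_swap_cols (r s : Fin m) (c d : Fin n) :
    Ideal.span (insert (X (r, c) * X (s, d) + X (r, d) * X (s, c) :
        MvPolynomial (Fin m × Fin n) F)
      ((fun x => (X x : MvPolynomial (Fin m × Fin n) F)) ''
        {x | ¬((x.1 = r ∨ x.1 = s) ∧ (x.2 = c ∨ x.2 = d))})) =
    Ideal.span (insert (X (r, d) * X (s, c) + X (r, c) * X (s, d) :
        MvPolynomial (Fin m × Fin n) F)
      ((fun x => (X x : MvPolynomial (Fin m × Fin n) F)) ''
        {x | ¬((x.1 = r ∨ x.1 = s) ∧ (x.2 = d ∨ x.2 = c))})) := by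
  congr 2
  · ring
  · ext x
    simp only [or_comm]

/-- **Laubenbacher–Swanson 2000, Lemma 5.2 (3)** ("`I₃ = P₂(M) + ⟨x_{ip} x_{jq} x_{kr} | i ≠ j ≠ k ≠ i⟩
+ ⟨x_{ip} x_{jq} x_{kr} | p ≠ q ≠ r ≠ p⟩`, where one or both of the first two ideals may be zero
if `m` or `n` is `2`"; `I₃ = ⋂_{P ∈ 𝒫₃} P` the intersection of the type (3) primes), for
`m, n ≥ 2`, PROVED as printed: "an easy application of" Niermann's Lemma 5.3 with
`I_b = (per_b)`, `J_b` = (variables off the block `b`), over ordered blocks `r < s`, `c < d`;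
then `Σ_b (per_b) = P₂(M)` and `⋂_b J_b` = the monomials not inside any `2 × 2` block = those with
three distinct rows or three distinct columns.
[cite: LaubenbacherSwanson2000, Lemma 5.2 (3) (arXiv text p0007 L58–113)] -/
theorem lemma_5_2_3 (hm : 2 ≤ m) (hn : 2 ≤ n) :
    ⨅ (r : Fin m) (s : Fin m) (c : Fin n) (d : Fin n) (_ : r ≠ s) (_ : c ≠ d),
      Ideal.span (insert (X (r, c) * X (s, d) + X (r, d) * X (s, c) :
          MvPolynomial (Fin m × Fin n) F)
        ((fun x => (X x : MvPolynomial (Fin m × Fin n) F)) ''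
          {x | ¬((x.1 = r ∨ x.1 = s) ∧ (x.2 = c ∨ x.2 = d))})) =
    subpermIdeal F m n 2 ⊔
      Ideal.span {f : MvPolynomial (Fin m × Fin n) F | ∃ a b c : Fin m × Fin n,
        (a.1 ≠ b.1 ∧ a.1 ≠ c.1 ∧ b.1 ≠ c.1) ∧ f = X a * X b * X c} ⊔
      Ideal.span {f : MvPolynomial (Fin m × Fin n) F | ∃ a b c : Fin m × Fin n,
        (a.2 ≠ b.2 ∧ a.2 ≠ c.2 ∧ b.2 ≠ c.2) ∧ f = X a * X b * X c} := by
  classical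
  -- ordered blocks
  let B := {b : (Fin m × Fin m) × (Fin n × Fin n) // b.1.1 < b.1.2 ∧ b.2.1 < b.2.2}
  let per : B → MvPolynomial (Fin m × Fin n) F := fun b =>
    X (b.1.1.1, b.1.2.1) * X (b.1.1.2, b.1.2.2) + X (b.1.1.1, b.1.2.2) * X (b.1.1.2, b.1.2.1)
  let off : B → Set (Fin m × Fin n) := fun b =>
    {x | ¬((x.1 = b.1.1.1 ∨ x.1 = b.1.1.2) ∧ (x.2 = b.1.2.1 ∨ x.2 = b.1.2.2))}
  let I : B → Ideal (MvPolynomial (Fin m × Fin n) F) := fun b => Ideal.span {per b}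
  let J : B → Ideal (MvPolynomial (Fin m × Fin n) F) := fun b =>
    Ideal.span ((fun x => (X x : MvPolynomial (Fin m × Fin n) F)) '' off b)
  -- Step 1: the intersection over all blocks is the intersection over ordered blocks of `I_b ⊔ J_b`
  have hblock : ∀ b : B, Ideal.span (insert (per b)
      ((fun x => (X x : MvPolynomial (Fin m × Fin n) F)) '' off b)) = I b ⊔ J b := fun b =>
    Ideal.span_insert _ _
  have hLHS : (⨅ (r : Fin m) (s : Fin m) (c : Fin n) (d : Fin n) (_ : r ≠ s) (_ : c ≠ d),
      Ideal.span (insert (X (r, c) * X (s, d) + X (r, d) * X (s, c) :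
          MvPolynomial (Fin m × Fin n) F)
        ((fun x => (X x : MvPolynomial (Fin m × Fin n) F)) ''
          {x | ¬((x.1 = r ∨ x.1 = s) ∧ (x.2 = c ∨ x.2 = d))}))) = ⨅ b : B, (I b ⊔ J b) := by
    apply le_antisymm
    · refine le_iInf fun b => ?_
      rw [← hblock b]
      exact (iInf_le _ b.1.1.1).trans ((iInf_le _ b.1.1.2).trans ((iInf_le _ b.1.2.1).trans
        ((iInf_le _ b.1.2.2).trans ((iInf_le _ (ne_of_lt b.2.1)).trans (iInf_le _ (ne_of_lt b.2.2))))))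
    · refine le_iInf fun r => le_iInf fun s => le_iInf fun c => le_iInf fun d =>
        le_iInf fun hrs => le_iInf fun hcd => ?_
      -- sort the block
      rcases lt_or_gt_of_ne hrs with hrs' | hrs' <;> rcases lt_or_gt_of_ne hcd with hcd' | hcd'
      · refine (iInf_le _ ⟨((r, s), (c, d)), hrs', hcd'⟩).trans (le_of_eq ?_)
        rw [← hblock]
      · refine (iInf_le _ ⟨((r, s), (d, c)), hrs', hcd'⟩).trans (le_of_eq ?_)
        rw [← hblock, blockIdeal_swap_cols F r s c d]
      · refine (iInf_le _ ⟨((s, r), (c, d)), hrs', hcd'⟩).trans (le_of_eq ?_)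
        rw [← hblock, blockIdeal_swap_rows F r s c d]
      · refine (iInf_le _ ⟨((s, r), (d, c)), hrs', hcd'⟩).trans (le_of_eq ?_)
        rw [← hblock, blockIdeal_swap_rows F r s c d, blockIdeal_swap_cols F s r c d]
  rw [hLHS]
  -- Step 2: Niermann's lemma
  have hIJ : ∀ b b' : B, b ≠ b' → I b ≤ J b' := by
    intro b b' hbb'
    rw [Ideal.span_singleton_le_iff_mem]
    obtain ⟨⟨⟨r, s⟩, ⟨c, d⟩⟩, hrs, hcd⟩ := b
    obtain ⟨⟨⟨r', s'⟩, ⟨c', d'⟩⟩, hrs', hcd'⟩ := b'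
    have hne : ¬((r = r' ∧ s = s') ∧ (c = c' ∧ d = d')) := fun h =>
      hbb' (Subtype.ext (Prod.ext (Prod.ext h.1.1 h.1.2) (Prod.ext h.2.1 h.2.2)))
    simp only at hrs hcd hrs' hcd'
    change (X (r, c) * X (s, d) + X (r, d) * X (s, c) : MvPolynomial (Fin m × Fin n) F) ∈
      Ideal.span ((fun x => (X x : MvPolynomial (Fin m × Fin n) F)) ''
        {x | ¬((x.1 = r' ∨ x.1 = s') ∧ (x.2 = c' ∨ x.2 = d'))})
    have hmem : ∀ x : Fin m × Fin n, ¬((x.1 = r' ∨ x.1 = s') ∧ (x.2 = c' ∨ x.2 = d')) →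
        (X x : MvPolynomial (Fin m × Fin n) F) ∈
          Ideal.span ((fun x => (X x : MvPolynomial (Fin m × Fin n) F)) ''
            {x | ¬((x.1 = r' ∨ x.1 = s') ∧ (x.2 = c' ∨ x.2 = d'))}) :=
      fun x hx => Ideal.subset_span ⟨x, hx, rfl⟩
    -- a row of `b` off the rows of `b'`, or a column of `b` off the columns of `b'`
    have hrow_or_col : (¬(r = r' ∨ r = s') ∨ ¬(s = r' ∨ s = s')) ∨
        (¬(c = c' ∨ c = d') ∨ ¬(d = c' ∨ d = d')) := by
      have h1 := Fin.lt_def.1 hrs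
      have h2 := Fin.lt_def.1 hrs'
      have h3 := Fin.lt_def.1 hcd
      have h4 := Fin.lt_def.1 hcd'
      simp only [Fin.ext_iff] at hne ⊢
      omega
    rcases hrow_or_col with (h | h) | (h | h)
    · exact Ideal.add_mem _ (Ideal.mul_mem_right _ _ (hmem (r, c) fun hx => h hx.1))
        (Ideal.mul_mem_right _ _ (hmem (r, d) fun hx => h hx.1))
    · exact Ideal.add_mem _ (Ideal.mul_mem_left _ _ (hmem (s, d) fun hx => h hx.1))
        (Ideal.mul_mem_left _ _ (hmem (s, c) fun hx => h hx.1))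
    · exact Ideal.add_mem _ (Ideal.mul_mem_right _ _ (hmem (r, c) fun hx => h hx.2))
        (Ideal.mul_mem_left _ _ (hmem (s, c) fun hx => h hx.2))
    · exact Ideal.add_mem _ (Ideal.mul_mem_left _ _ (hmem (s, d) fun hx => h hx.2))
        (Ideal.mul_mem_right _ _ (hmem (r, d) fun hx => h hx.2))
  rw [lemma_5_3 I J hIJ]
  -- Step 3: `Σ_b (per_b) = P₂(M)`
  have hI : (⨆ b : B, I b) = subpermIdeal F m n 2 := by
    apply le_antisymm
    · refine iSup_le fun b => ?_
      rw [Ideal.span_singleton_le_iff_mem]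
      exact pair_mem_subpermIdeal_two F (ne_of_lt b.2.1) (ne_of_lt b.2.2)
    · refine subpermIdeal_two_le_of_pairs' _ fun r s c d hrs hcd => ?_
      have hgen : ∀ b : B, per b ∈ ⨆ b : B, I b := fun b =>
        Ideal.mem_iSup_of_mem b (Ideal.mem_span_singleton_self _)
      rcases lt_or_gt_of_ne hrs with hrs' | hrs' <;> rcases lt_or_gt_of_ne hcd with hcd' | hcd'
      · exact hgen ⟨((r, s), (c, d)), hrs', hcd'⟩
      · have h := hgen ⟨((r, s), (d, c)), hrs', hcd'⟩
        have e : (X (r, c) * X (s, d) + X (r, d) * X (s, c) : MvPolynomial (Fin m × Fin n) F) =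
            X (r, d) * X (s, c) + X (r, c) * X (s, d) := by ring
        rw [e]; exact h
      · have h := hgen ⟨((s, r), (c, d)), hrs', hcd'⟩
        have e : (X (r, c) * X (s, d) + X (r, d) * X (s, c) : MvPolynomial (Fin m × Fin n) F) =
            X (s, c) * X (r, d) + X (s, d) * X (r, c) := by ring
        rw [e]; exact h
      · have h := hgen ⟨((s, r), (d, c)), hrs', hcd'⟩
        have e : (X (r, c) * X (s, d) + X (r, d) * X (s, c) : MvPolynomial (Fin m × Fin n) F) =
            X (s, d) * X (r, c) + X (s, c) * X (r, d) := by ring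
        rw [e]; exact h
  rw [hI]
  -- Step 4: `⋂_b J_b` = the monomials on three distinct rows or three distinct columns
  have hJ : (⨅ b : B, J b) =
      Ideal.span {f : MvPolynomial (Fin m × Fin n) F | ∃ a b c : Fin m × Fin n,
          (a.1 ≠ b.1 ∧ a.1 ≠ c.1 ∧ b.1 ≠ c.1) ∧ f = X a * X b * X c} ⊔
        Ideal.span {f : MvPolynomial (Fin m × Fin n) F | ∃ a b c : Fin m × Fin n,
          (a.2 ≠ b.2 ∧ a.2 ≠ c.2 ∧ b.2 ≠ c.2) ∧ f = X a * X b * X c} := by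
    apply le_antisymm
    · intro f hf
      rw [Submodule.mem_iInf] at hf
      refine mem_ideal_of_monomial_mem fun u hu => ?_
      by_cases hR : ∃ a b c : Fin m × Fin n, (a.1 ≠ b.1 ∧ a.1 ≠ c.1 ∧ b.1 ≠ c.1) ∧
          u a ≠ 0 ∧ u b ≠ 0 ∧ u c ≠ 0
      · obtain ⟨a, b, c, habc, ha, hb, hc⟩ := hR
        refine Ideal.mem_sup_left ((mem_span_tripleMul_iff _ (fun a b c h =>
          ⟨fun e => h.1 (congrArg Prod.fst e), fun e => h.2.1 (congrArg Prod.fst e),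
            fun e => h.2.2 (congrArg Prod.fst e)⟩) _).2 fun u' hu' => ?_)
        obtain rfl : u' = u := Finset.mem_singleton.1 (support_monomial_subset hu')
        exact ⟨a, b, c, habc, ha, hb, hc⟩
      by_cases hC : ∃ a b c : Fin m × Fin n, (a.2 ≠ b.2 ∧ a.2 ≠ c.2 ∧ b.2 ≠ c.2) ∧
          u a ≠ 0 ∧ u b ≠ 0 ∧ u c ≠ 0
      · obtain ⟨a, b, c, habc, ha, hb, hc⟩ := hC
        refine Ideal.mem_sup_right ((mem_span_tripleMul_iff _ (fun a b c h =>
          ⟨fun e => h.1 (congrArg Prod.snd e), fun e => h.2.1 (congrArg Prod.snd e),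
            fun e => h.2.2 (congrArg Prod.snd e)⟩) _).2 fun u' hu' => ?_)
        obtain rfl : u' = u := Finset.mem_singleton.1 (support_monomial_subset hu')
        exact ⟨a, b, c, habc, ha, hb, hc⟩
      · exfalso
        obtain ⟨r, s, hrs, hrow⟩ := exists_rows_cover hm u hR
        obtain ⟨c, d, hcd, hcol⟩ := exists_cols_cover hn u hC
        obtain ⟨x, hx, hux⟩ := mem_ideal_span_X_image.1 (hf ⟨((r, s), (c, d)), hrs, hcd⟩) u hu
        exact hx ⟨hrow x hux, hcol x hux⟩
    · refine sup_le ?_ ?_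
      · rw [Ideal.span_le]
        rintro f ⟨a, b, c, ⟨hab, hac, hbc⟩, rfl⟩
        rw [SetLike.mem_coe, Submodule.mem_iInf]
        rintro ⟨⟨⟨r, s⟩, ⟨c', d'⟩⟩, hrs, hcd⟩
        change (X a * X b * X c : MvPolynomial (Fin m × Fin n) F) ∈
          Ideal.span ((fun x => (X x : MvPolynomial (Fin m × Fin n) F)) ''
            {x | ¬((x.1 = r ∨ x.1 = s) ∧ (x.2 = c' ∨ x.2 = d'))})
        -- one of the three rows is off `{r, s}`
        by_cases ha : a.1 = r ∨ a.1 = s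
        · by_cases hb : b.1 = r ∨ b.1 = s
          · have hc' : ¬(c.1 = r ∨ c.1 = s) := by
              rcases ha with ha | ha <;> rcases hb with hb | hb
              · exact absurd (ha.trans hb.symm) hab
              · rintro (h | h)
                · exact hac (ha.trans h.symm)
                · exact hbc (hb.trans h.symm)
              · rintro (h | h)
                · exact hbc (hb.trans h.symm)
                · exact hac (ha.trans h.symm)
              · exact absurd (ha.trans hb.symm) hab
            exact Ideal.mul_mem_left _ _ (Ideal.subset_span ⟨c, fun h => hc' h.1, rfl⟩)
          · exact Ideal.mul_mem_right _ _
              (Ideal.mul_mem_left _ _ (Ideal.subset_span ⟨b, fun h => hb h.1, rfl⟩))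
        · exact Ideal.mul_mem_right _ _
            (Ideal.mul_mem_right _ _ (Ideal.subset_span ⟨a, fun h => ha h.1, rfl⟩))
      · rw [Ideal.span_le]
        rintro f ⟨a, b, c, ⟨hab, hac, hbc⟩, rfl⟩
        rw [SetLike.mem_coe, Submodule.mem_iInf]
        rintro ⟨⟨⟨r, s⟩, ⟨c', d'⟩⟩, hrs, hcd⟩
        change (X a * X b * X c : MvPolynomial (Fin m × Fin n) F) ∈
          Ideal.span ((fun x => (X x : MvPolynomial (Fin m × Fin n) F)) ''
            {x | ¬((x.1 = r ∨ x.1 = s) ∧ (x.2 = c' ∨ x.2 = d'))})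
        by_cases ha : a.2 = c' ∨ a.2 = d'
        · by_cases hb : b.2 = c' ∨ b.2 = d'
          · have hc' : ¬(c.2 = c' ∨ c.2 = d') := by
              rcases ha with ha | ha <;> rcases hb with hb | hb
              · exact absurd (ha.trans hb.symm) hab
              · rintro (h | h)
                · exact hac (ha.trans h.symm)
                · exact hbc (hb.trans h.symm)
              · rintro (h | h)
                · exact hbc (hb.trans h.symm)
                · exact hac (ha.trans h.symm)
              · exact absurd (ha.trans hb.symm) hab
            exact Ideal.mul_mem_left _ _ (Ideal.subset_span ⟨c, fun h => hc' h.2, rfl⟩)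
          · exact Ideal.mul_mem_right _ _
              (Ideal.mul_mem_left _ _ (Ideal.subset_span ⟨b, fun h => hb h.2, rfl⟩))
        · exact Ideal.mul_mem_right _ _
            (Ideal.mul_mem_right _ _ (Ideal.subset_span ⟨a, fun h => ha h.2, rfl⟩))
  rw [hJ, sup_assoc]

end Lemma52

/-! ### §F. Theorem 5.4: the radical of `P₂(M)` -/

section Theorem54

variable (F : Type*) [Field F] {m n : ℕ}

/-- **Theorem 5.4, first displayed equality** ("`rad(P₂(M)) = I₁ ∩ I₂ ∩ I₃`", p0007 L126 and
L169): over a field with `2 ≠ 0` and for `m, n ≥ 1`, the radical of `P₂(M)` is the intersection of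
all the type (1), type (2) and type (3) ideals of Theorem 4.1 (they are primes over `P₂(M)`, and
every prime over `P₂(M)` contains one of them — `thm_4_1_contains`).  Typed for all `m, n ≥ 1`
⊇ printed `m, n ≥ 3` (for `m = 2` the paper writes `I₁ ∩ I₃`, which is the same ideal).
[cite: LaubenbacherSwanson2000, Thm. 5.4 (arXiv text p0007 L118–182)] -/
theorem radical_eq_inf (h2 : (2 : F) ≠ 0) (hm : 1 ≤ m) (hn : 1 ≤ n) :
    (subpermIdeal F m n 2).radical =
      (⨅ r : Fin m, Ideal.span ((fun x => (X x : MvPolynomial (Fin m × Fin n) F)) ''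
          {x | x.1 ≠ r})) ⊓
      (⨅ c : Fin n, Ideal.span ((fun x => (X x : MvPolynomial (Fin m × Fin n) F)) ''
          {x | x.2 ≠ c})) ⊓
      ⨅ (r : Fin m) (s : Fin m) (c : Fin n) (d : Fin n) (_ : r ≠ s) (_ : c ≠ d),
        Ideal.span (insert (X (r, c) * X (s, d) + X (r, d) * X (s, c) :
            MvPolynomial (Fin m × Fin n) F)
          ((fun x => (X x : MvPolynomial (Fin m × Fin n) F)) ''
            {x | ¬((x.1 = r ∨ x.1 = s) ∧ (x.2 = c ∨ x.2 = d))})) := by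
  apply le_antisymm
  · refine le_inf (le_inf (le_iInf fun r => ?_) (le_iInf fun c => ?_))
      (le_iInf fun r => le_iInf fun s => le_iInf fun c => le_iInf fun d =>
        le_iInf fun hrs => le_iInf fun hcd => ?_)
    · exact (Ideal.IsPrime.radical_le_iff (isPrime_span_X_image _)).2
        (subpermIdeal_two_le_rowIdeal F r)
    · exact (Ideal.IsPrime.radical_le_iff (isPrime_span_X_image _)).2
        (subpermIdeal_two_le_colIdeal F c)
    · exact (Ideal.IsPrime.radical_le_iff (isPrime_blockIdeal hrs hcd)).2
        (subpermIdeal_two_le_blockIdeal F)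
  · rw [Ideal.radical_eq_sInf]
    refine le_sInf fun J hJ => ?_
    obtain ⟨hJ, hJp⟩ := hJ
    rcases thm_4_1_contains F h2 hm hn J hJ with
      ⟨r, hr⟩ | ⟨c, hc⟩ | ⟨r, s, c, d, hrs, hcd, -, hoff, hper⟩
    · refine inf_le_left.trans (inf_le_left.trans ((iInf_le _ r).trans ?_))
      rw [Ideal.span_le]
      rintro g ⟨x, hx, rfl⟩
      exact hr x.1 x.2 hx
    · refine inf_le_left.trans (inf_le_right.trans ((iInf_le _ c).trans ?_))
      rw [Ideal.span_le]
      rintro g ⟨x, hx, rfl⟩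
      exact hc x.1 x.2 hx
    · refine inf_le_right.trans ((iInf_le _ r).trans ((iInf_le _ s).trans ((iInf_le _ c).trans
        ((iInf_le _ d).trans ((iInf_le _ hrs).trans ((iInf_le _ hcd).trans ?_))))))
      rw [Ideal.span_le]
      rintro g (rfl | ⟨x, hx, rfl⟩)
      · exact hper
      · exact hoff x.1 x.2 hx

/-- **The monomial step of Theorem 5.4** (LS p0007 L169–182: "`⟨x_{ij}x_{lk} | j ≠ k, i ≠ l⟩ ∩
(P₂ + ⟨x_{ip}x_{jq}x_{kr} | i,j,k distinct or p,q,r distinct⟩) = P₂ +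
⟨x_{ip}x_{jq}x_{kr} | i,j,k distinct and p,q,r distinct⟩`, the latter equality by Lemma 2.1"):
a monomial involving two distinct rows, two distinct columns, and three distinct rows or three
distinct columns, lies in `P₂(M) + ⟨x_{ip}x_{jq}x_{kr} | i, j, k distinct and p, q, r distinct⟩`
(`2` a unit). [cite: LaubenbacherSwanson2000, proof of Thm. 5.4 (arXiv text p0007 L164–182)] -/
theorem monomial_mem_sup_of_spread {F : Type*} [CommRing F] (h2 : IsUnit (2 : F))
    {u : Fin m × Fin n →₀ ℕ}
    (hR : ∃ a b : Fin m × Fin n, a.1 ≠ b.1 ∧ u a ≠ 0 ∧ u b ≠ 0)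
    (hC : ∃ a b : Fin m × Fin n, a.2 ≠ b.2 ∧ u a ≠ 0 ∧ u b ≠ 0)
    (h3 : ∃ a b c : Fin m × Fin n, ((a.1 ≠ b.1 ∧ a.1 ≠ c.1 ∧ b.1 ≠ c.1) ∨
      (a.2 ≠ b.2 ∧ a.2 ≠ c.2 ∧ b.2 ≠ c.2)) ∧ u a ≠ 0 ∧ u b ≠ 0 ∧ u c ≠ 0) :
    (monomial u (1 : F) : MvPolynomial (Fin m × Fin n) F) ∈ subpermIdeal F m n 2 ⊔
      Ideal.span {f : MvPolynomial (Fin m × Fin n) F | ∃ a b c : Fin m × Fin n,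
        (a.1 ≠ b.1 ∧ a.1 ≠ c.1 ∧ b.1 ≠ c.1) ∧ (a.2 ≠ b.2 ∧ a.2 ≠ c.2 ∧ b.2 ≠ c.2) ∧
          f = X a * X b * X c} := by
  -- a product of three entries of `M` over three distinct rows and at most two columns, or
  -- three distinct columns and at most two rows, lies in `P₂(M)` (Lemma 2.1)
  have hcols : ∀ a b c : Fin m × Fin n, a.1 ≠ b.1 → a.1 ≠ c.1 → b.1 ≠ c.1 → a.2 = b.2 →
      a.2 ≠ c.2 → (X a * X b * X c : MvPolynomial (Fin m × Fin n) F) ∈ subpermIdeal F m n 2 := by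
    rintro ⟨i, p⟩ ⟨j, q⟩ ⟨k, r⟩ hij hik hjk hpq hpr
    simp only at hij hik hjk hpq hpr
    subst hpq
    exact lemma_2_1_cols h2 hij hik hjk hpr
  have hrows : ∀ a b c : Fin m × Fin n, a.2 ≠ b.2 → a.2 ≠ c.2 → b.2 ≠ c.2 → a.1 = b.1 →
      a.1 ≠ c.1 → (X a * X b * X c : MvPolynomial (Fin m × Fin n) F) ∈ subpermIdeal F m n 2 := by
    rintro ⟨i, p⟩ ⟨j, q⟩ ⟨k, r⟩ hpq hpr hqr hij hik
    simp only at hpq hpr hqr hij hik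
    subst hij
    exact lemma_2_1_rows h2 hik hpq hpr hqr
  obtain ⟨a, b, c, habc, ha, hb, hc⟩ := h3
  rcases habc with ⟨hab, hac, hbc⟩ | ⟨hab, hac, hbc⟩
  · -- three distinct rows
    have hab' : a ≠ b := fun e => hab (congrArg Prod.fst e)
    have hac' : a ≠ c := fun e => hac (congrArg Prod.fst e)
    have hbc' : b ≠ c := fun e => hbc (congrArg Prod.fst e)
    by_cases hpq : a.2 = b.2
    · by_cases hpr : a.2 = c.2
      · -- all three in one column: use a support point `y` in another column
        obtain ⟨y₁, y₂, hy, hy₁, hy₂⟩ := hC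
        obtain ⟨y, hyc, huy⟩ : ∃ y : Fin m × Fin n, y.2 ≠ a.2 ∧ u y ≠ 0 := by
          by_cases h : y₁.2 = a.2
          · exact ⟨y₂, fun e => hy (h.trans e.symm), hy₂⟩
          · exact ⟨y₁, h, hy₁⟩
        -- two of `a, b, c` have a row different from `y.1`
        by_cases hya : y.1 = a.1
        · have hyb : b.1 ≠ y.1 := fun e => hab (e.trans hya).symm
          have hyc' : c.1 ≠ y.1 := fun e => hac (e.trans hya).symm
          exact Ideal.mem_sup_left (monomial_mem_of_triple_mem hbc'
            (fun e => hyb (congrArg Prod.fst e)) (fun e => hyc' (congrArg Prod.fst e)) hb hc huy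
            (hcols b c y hbc hyb hyc' (hpq.symm.trans hpr) (fun e => hyc (e.symm.trans hpq.symm))))
        · have hya' : a.1 ≠ y.1 := fun e => hya e.symm
          by_cases hyb : y.1 = b.1
          · have hyc' : c.1 ≠ y.1 := fun e => hbc (e.trans hyb).symm
            exact Ideal.mem_sup_left (monomial_mem_of_triple_mem hac'
              (fun e => hya' (congrArg Prod.fst e)) (fun e => hyc' (congrArg Prod.fst e)) ha hc
              huy (hcols a c y hac hya' hyc' hpr (fun e => hyc e.symm)))
          · have hyb' : b.1 ≠ y.1 := fun e => hyb e.symm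
            exact Ideal.mem_sup_left (monomial_mem_of_triple_mem hab'
              (fun e => hya' (congrArg Prod.fst e)) (fun e => hyb' (congrArg Prod.fst e)) ha hb
              huy (hcols a b y hab hya' hyb' hpq (fun e => hyc e.symm)))
      · -- columns `a = b ≠ c`
        exact Ideal.mem_sup_left (monomial_mem_of_triple_mem hab' hac' hbc' ha hb hc
          (hcols a b c hab hac hbc hpq hpr))
    · by_cases hpr : a.2 = c.2
      · -- columns `a = c ≠ b`: use the triple `(a, c, b)`
        have h := hcols a c b hac hab hbc.symm hpr hpq
        have e : (X a * X c * X b : MvPolynomial (Fin m × Fin n) F) = X a * X b * X c := by ring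
        rw [e] at h
        exact Ideal.mem_sup_left (monomial_mem_of_triple_mem hab' hac' hbc' ha hb hc h)
      · by_cases hqr : b.2 = c.2
        · -- columns `b = c ≠ a`: the triple `(b, c, a)`
          have h := hcols b c a hbc hab.symm hac.symm hqr (fun e => hpq e.symm)
          have e : (X b * X c * X a : MvPolynomial (Fin m × Fin n) F) = X a * X b * X c := by ring
          rw [e] at h
          exact Ideal.mem_sup_left (monomial_mem_of_triple_mem hab' hac' hbc' ha hb hc h)
        · -- three distinct rows and three distinct columns: a generator of the second summand
          exact Ideal.mem_sup_right (monomial_mem_of_triple_mem hab' hac' hbc' ha hb hc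
            (Ideal.subset_span ⟨a, b, c, ⟨hab, hac, hbc⟩, ⟨hpq, hpr, hqr⟩, rfl⟩))
  · -- three distinct columns (the transposed argument)
    have hab' : a ≠ b := fun e => hab (congrArg Prod.snd e)
    have hac' : a ≠ c := fun e => hac (congrArg Prod.snd e)
    have hbc' : b ≠ c := fun e => hbc (congrArg Prod.snd e)
    by_cases hij : a.1 = b.1
    · by_cases hik : a.1 = c.1
      · obtain ⟨y₁, y₂, hy, hy₁, hy₂⟩ := hR
        obtain ⟨y, hyr, huy⟩ : ∃ y : Fin m × Fin n, y.1 ≠ a.1 ∧ u y ≠ 0 := by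
          by_cases h : y₁.1 = a.1
          · exact ⟨y₂, fun e => hy (h.trans e.symm), hy₂⟩
          · exact ⟨y₁, h, hy₁⟩
        by_cases hya : y.2 = a.2
        · have hyb : b.2 ≠ y.2 := fun e => hab (e.trans hya).symm
          have hyc' : c.2 ≠ y.2 := fun e => hac (e.trans hya).symm
          exact Ideal.mem_sup_left (monomial_mem_of_triple_mem hbc'
            (fun e => hyb (congrArg Prod.snd e)) (fun e => hyc' (congrArg Prod.snd e)) hb hc huy
            (hrows b c y hbc hyb hyc' (hij.symm.trans hik) (fun e => hyr (e.symm.trans hij.symm))))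
        · have hya' : a.2 ≠ y.2 := fun e => hya e.symm
          by_cases hyb : y.2 = b.2
          · have hyc' : c.2 ≠ y.2 := fun e => hbc (e.trans hyb).symm
            exact Ideal.mem_sup_left (monomial_mem_of_triple_mem hac'
              (fun e => hya' (congrArg Prod.snd e)) (fun e => hyc' (congrArg Prod.snd e)) ha hc
              huy (hrows a c y hac hya' hyc' hik (fun e => hyr e.symm)))
          · have hyb' : b.2 ≠ y.2 := fun e => hyb e.symm
            exact Ideal.mem_sup_left (monomial_mem_of_triple_mem hab'
              (fun e => hya' (congrArg Prod.snd e)) (fun e => hyb' (congrArg Prod.snd e)) ha hb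
              huy (hrows a b y hab hya' hyb' hij (fun e => hyr e.symm)))
      · exact Ideal.mem_sup_left (monomial_mem_of_triple_mem hab' hac' hbc' ha hb hc
          (hrows a b c hab hac hbc hij hik))
    · by_cases hik : a.1 = c.1
      · have h := hrows a c b hac hab hbc.symm hik hij
        have e : (X a * X c * X b : MvPolynomial (Fin m × Fin n) F) = X a * X b * X c := by ring
        rw [e] at h
        exact Ideal.mem_sup_left (monomial_mem_of_triple_mem hab' hac' hbc' ha hb hc h)
      · by_cases hjk : b.1 = c.1
        · have h := hrows b c a hbc hab.symm hac.symm hjk (fun e => hij e.symm)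
          have e : (X b * X c * X a : MvPolynomial (Fin m × Fin n) F) = X a * X b * X c := by ring
          rw [e] at h
          exact Ideal.mem_sup_left (monomial_mem_of_triple_mem hab' hac' hbc' ha hb hc h)
        · exact Ideal.mem_sup_right (monomial_mem_of_triple_mem hab' hac' hbc' ha hb hc
            (Ideal.subset_span ⟨a, b, c, ⟨hij, hik, hjk⟩, ⟨hab, hac, hbc⟩, rfl⟩))

/-- The ideal `⟨x_{ip}x_{jq}x_{kr} | i, j, k distinct and p, q, r distinct⟩` vanishes when `m ≤ 2`
or `n ≤ 2` (no three distinct rows, resp. columns) — the case "If `m` or `n` is equal to `2`" of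
Thm. 5.4. [cite: LaubenbacherSwanson2000, Thm. 5.4 (arXiv text p0007 L118–121)] -/
theorem span_permTriple_eq_bot {F : Type*} [CommRing F] (h : m ≤ 2 ∨ n ≤ 2) :
    Ideal.span {f : MvPolynomial (Fin m × Fin n) F | ∃ a b c : Fin m × Fin n,
        (a.1 ≠ b.1 ∧ a.1 ≠ c.1 ∧ b.1 ≠ c.1) ∧ (a.2 ≠ b.2 ∧ a.2 ≠ c.2 ∧ b.2 ≠ c.2) ∧
          f = X a * X b * X c} = ⊥ := by
  rw [Ideal.span_eq_bot]
  rintro f ⟨a, b, c, ⟨h1, h2, h3⟩, ⟨h4, h5, h6⟩, rfl⟩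
  exfalso
  have := a.1.isLt; have := b.1.isLt; have := c.1.isLt
  have := a.2.isLt; have := b.2.isLt; have := c.2.isLt
  simp only [ne_eq, Fin.ext_iff] at h1 h2 h3 h4 h5 h6
  omega

/-- `P₂(M) = 0` when `M` has only one row or only one column (there are no `2 × 2` submatrices;
LS take `m, n` positive and `P_r(M)` generated by the `r × r` subpermanents).
[cite: LaubenbacherSwanson2000, §1 (definition of `P_r(M)`, arXiv text p0002 L36–41)] -/
theorem subpermIdeal_two_eq_bot {F : Type*} [CommRing F] (h : m < 2 ∨ n < 2) :
    subpermIdeal F m n 2 = ⊥ := by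
  rw [subpermIdeal, Ideal.span_eq_bot]
  rintro f ⟨Rw, Cl, hR, hC, rfl⟩
  exfalso
  have h1 := Finset.card_le_univ Rw
  have h2 := Finset.card_le_univ Cl
  simp only [Fintype.card_fin] at h1 h2
  omega

/-- **Laubenbacher–Swanson 2000, Theorem 5.4** ("If `m` or `n` is equal to `2`, then
`rad(P₂(M)) = P₂(M)`.  If `m, n ≥ 3`, then `rad(P₂(M)) = I₁ ∩ I₂ ∩ I₃ =
P₂(M) + ⟨x_{ip} x_{jq} x_{kr} | i ≠ j ≠ k ≠ i, p ≠ q ≠ r ≠ p⟩`."), both displayed cases in ONE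
formula for `m, n ≥ 2` over a field with `2 ≠ 0` (for `m = 2` or `n = 2` the second summand is
`0`, `span_permTriple_eq_bot`): the radical of `P₂(M)` is `P₂(M)` plus the ideal of the products
of three entries from three distinct rows and three distinct columns.  Proof as printed
(`radical_eq_inf`, Lemma 5.2 (3) via Niermann, the modular law, and the monomial step
`monomial_mem_sup_of_spread` by Lemma 2.1).
[cite: LaubenbacherSwanson2000, Thm. 5.4 (arXiv text p0007 L118–186)] -/
theorem thm_5_4 (h2 : (2 : F) ≠ 0) (hm : 2 ≤ m) (hn : 2 ≤ n) :
    (subpermIdeal F m n 2).radical = subpermIdeal F m n 2 ⊔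
      Ideal.span {f : MvPolynomial (Fin m × Fin n) F | ∃ a b c : Fin m × Fin n,
        (a.1 ≠ b.1 ∧ a.1 ≠ c.1 ∧ b.1 ≠ c.1) ∧ (a.2 ≠ b.2 ∧ a.2 ≠ c.2 ∧ b.2 ≠ c.2) ∧
          f = X a * X b * X c} := by
  classical
  rw [radical_eq_inf F h2 (by omega) (by omega), lemma_5_2_3 F hm hn]
  have hP : subpermIdeal F m n 2 ≤
      (⨅ r : Fin m, Ideal.span ((fun x => (X x : MvPolynomial (Fin m × Fin n) F)) ''
          {x | x.1 ≠ r})) ⊓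
      (⨅ c : Fin n, Ideal.span ((fun x => (X x : MvPolynomial (Fin m × Fin n) F)) ''
          {x | x.2 ≠ c})) :=
    le_inf (le_iInf fun r => subpermIdeal_two_le_rowIdeal F r)
      (le_iInf fun c => subpermIdeal_two_le_colIdeal F c)
  apply le_antisymm
  · -- modular law: `(I₁ ∩ I₂) ∩ (P₂ + T') = P₂ + (I₁ ∩ I₂ ∩ T')`
    rw [sup_assoc, inf_comm, sup_inf_assoc_of_le _ hP]
    refine sup_le le_sup_left ?_
    rintro f ⟨hfT, hfR, hfC⟩
    rw [SetLike.mem_coe, Submodule.mem_iInf] at hfR hfC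
    refine mem_ideal_of_monomial_mem fun u hu => monomial_mem_sup_of_spread h2.isUnit ?_ ?_ ?_
    · obtain ⟨x, -, hx⟩ := mem_ideal_span_X_image.1 (hfR ⟨0, by omega⟩) u hu
      obtain ⟨y, hy, huy⟩ := mem_ideal_span_X_image.1 (hfR x.1) u hu
      exact ⟨y, x, hy, huy, hx⟩
    · obtain ⟨x, -, hx⟩ := mem_ideal_span_X_image.1 (hfC ⟨0, by omega⟩) u hu
      obtain ⟨y, hy, huy⟩ := mem_ideal_span_X_image.1 (hfC x.2) u hu
      exact ⟨y, x, hy, huy, hx⟩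
    · -- `f ∈ T₁ + T₂ = span (T₁ ∪ T₂)`
      have hfT' : f ∈ Ideal.span {f : MvPolynomial (Fin m × Fin n) F | ∃ a b c : Fin m × Fin n,
          ((a.1 ≠ b.1 ∧ a.1 ≠ c.1 ∧ b.1 ≠ c.1) ∨ (a.2 ≠ b.2 ∧ a.2 ≠ c.2 ∧ b.2 ≠ c.2)) ∧
            f = X a * X b * X c} := by
        have hle : Ideal.span {f : MvPolynomial (Fin m × Fin n) F | ∃ a b c : Fin m × Fin n,
              (a.1 ≠ b.1 ∧ a.1 ≠ c.1 ∧ b.1 ≠ c.1) ∧ f = X a * X b * X c} ⊔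
            Ideal.span {f : MvPolynomial (Fin m × Fin n) F | ∃ a b c : Fin m × Fin n,
              (a.2 ≠ b.2 ∧ a.2 ≠ c.2 ∧ b.2 ≠ c.2) ∧ f = X a * X b * X c} ≤
            Ideal.span {f : MvPolynomial (Fin m × Fin n) F | ∃ a b c : Fin m × Fin n,
              ((a.1 ≠ b.1 ∧ a.1 ≠ c.1 ∧ b.1 ≠ c.1) ∨ (a.2 ≠ b.2 ∧ a.2 ≠ c.2 ∧ b.2 ≠ c.2)) ∧
                f = X a * X b * X c} := by
          refine sup_le (Ideal.span_mono ?_) (Ideal.span_mono ?_)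
          · rintro g ⟨a, b, c, h, rfl⟩
            exact ⟨a, b, c, Or.inl h, rfl⟩
          · rintro g ⟨a, b, c, h, rfl⟩
            exact ⟨a, b, c, Or.inr h, rfl⟩
        exact hle hfT
      obtain ⟨a, b, c, habc, ha, hb, hc⟩ := (mem_span_tripleMul_iff _ (fun a b c h => by
        rcases h with h | h
        · exact ⟨fun e => h.1 (congrArg Prod.fst e), fun e => h.2.1 (congrArg Prod.fst e),
            fun e => h.2.2 (congrArg Prod.fst e)⟩
        · exact ⟨fun e => h.1 (congrArg Prod.snd e), fun e => h.2.1 (congrArg Prod.snd e),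
            fun e => h.2.2 (congrArg Prod.snd e)⟩) f).1 hfT' u hu
      exact ⟨a, b, c, habc, ha, hb, hc⟩
  · refine sup_le (le_inf hP (le_sup_left.trans le_sup_left)) ?_
    rw [Ideal.span_le]
    rintro f ⟨a, b, c, ⟨hab, hac, hbc⟩, ⟨hpq, hpr, hqr⟩, rfl⟩
    rw [SetLike.mem_coe, Submodule.mem_inf, Submodule.mem_inf]
    refine ⟨⟨?_, ?_⟩, ?_⟩
    · rw [Submodule.mem_iInf]
      intro r
      by_cases ha : a.1 = r
      · have hb : b.1 ≠ r := fun h => hab (ha.trans h.symm)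
        exact Ideal.mul_mem_right _ _ (Ideal.mul_mem_left _ _ (Ideal.subset_span ⟨b, hb, rfl⟩))
      · exact Ideal.mul_mem_right _ _ (Ideal.mul_mem_right _ _ (Ideal.subset_span ⟨a, ha, rfl⟩))
    · rw [Submodule.mem_iInf]
      intro c'
      by_cases ha : a.2 = c'
      · have hb : b.2 ≠ c' := fun h => hpq (ha.trans h.symm)
        exact Ideal.mul_mem_right _ _ (Ideal.mul_mem_left _ _ (Ideal.subset_span ⟨b, hb, rfl⟩))
      · exact Ideal.mul_mem_right _ _ (Ideal.mul_mem_right _ _ (Ideal.subset_span ⟨a, ha, rfl⟩))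
    · exact Ideal.mem_sup_left (Ideal.mem_sup_right
        (Ideal.subset_span ⟨a, b, c, ⟨hab, hac, hbc⟩, rfl⟩))

/-- **Theorem 5.4, first case** ("If `m` or `n` is equal to `2`, then `rad(P₂(M)) = P₂(M)`"), for
`m, n ≥ 2` over a field with `2 ≠ 0`. [cite: LaubenbacherSwanson2000, Thm. 5.4 (arXiv text p0007 L118–121, proof L136–162)] -/
theorem thm_5_4_of_two (h2 : (2 : F) ≠ 0) (hm : 2 ≤ m) (hn : 2 ≤ n) (h : m = 2 ∨ n = 2) :
    (subpermIdeal F m n 2).radical = subpermIdeal F m n 2 := by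
  rw [thm_5_4 F h2 hm hn, span_permTriple_eq_bot (by omega), sup_bot_eq]

/-- **Theorem 5.4, last sentence** ("So `P₂(M)` is a radical ideal if and only if `m ≤ 2` or
`n ≤ 2`."), over a field with `2 ≠ 0`, for ALL `m, n` (`m ≤ 1` or `n ≤ 1`: `P₂(M) = 0`).
The direction "only if" is `not_isRadical` (three distinct rows and columns give the non-radical
witness `x₁₁x₂₂x₃₃`). [cite: LaubenbacherSwanson2000, Thm. 5.4 (arXiv text p0007 L118–133)] -/
theorem isRadical_iff (h2 : (2 : F) ≠ 0) :
    (subpermIdeal F m n 2).IsRadical ↔ m ≤ 2 ∨ n ≤ 2 := by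
  constructor
  · intro hrad
    by_contra hmn
    simp only [not_or, not_le] at hmn
    exact not_isRadical h2.isUnit (by omega) (by omega) hrad
  · intro hmn
    by_cases hbot : m < 2 ∨ n < 2
    · rw [subpermIdeal_two_eq_bot hbot]
      exact Ideal.isRadical_bot
    · simp only [not_or, not_lt] at hbot
      rw [← Ideal.radical_eq_iff]
      exact thm_5_4_of_two F h2 hbot.1 hbot.2 (by omega)

end Theorem54

/-! ### §G. Proposition 5.1: the primary components at the minimal primes -/

section Prop51

variable (F : Type*) [Field F] {m n : ℕ}

/-- In at least three columns, two columns avoid a given one. [folklore] -/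
private theorem exists_ne_ne_of_three_le' (hn : 3 ≤ n) (a : Fin n) :
    ∃ p q : Fin n, p ≠ q ∧ p ≠ a ∧ q ≠ a := by
  by_cases h0 : a.val = 0
  · exact ⟨⟨1, by omega⟩, ⟨2, by omega⟩, by simp [Fin.ext_iff],
      by simp [Fin.ext_iff]; omega, by simp [Fin.ext_iff]; omega⟩
  by_cases h1 : a.val = 1
  · exact ⟨⟨0, by omega⟩, ⟨2, by omega⟩, by simp [Fin.ext_iff],
      by simp [Fin.ext_iff]; omega, by simp [Fin.ext_iff]; omega⟩
  · exact ⟨⟨0, by omega⟩, ⟨1, by omega⟩, by simp [Fin.ext_iff],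
      by simp [Fin.ext_iff]; omega, by simp [Fin.ext_iff]; omega⟩

/-- **Laubenbacher–Swanson 2000, Proposition 5.1** ("The primary components of `P₂(M)`
corresponding to the minimal primes over `P₂(M)` are exactly the minimal primes in `𝒫`
themselves."), typed in the localisation-free form: for every minimal prime `P` of `P₂(M)` and
every `x ∈ P` there is `s ∉ P` with `s x ∈ P₂(M)` — this IS "the `P`-primary component
`Q_P = P₂(M) R_P ∩ R` of `P₂(M)` equals `P`" unfolded (LS p0007 L22–24: "`Q_P` is characterized by
the property that `Q_P` contains a power of `P` and, if `r s ∈ Q_P` and `r ∉ P`, then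
`s ∈ Q_P`"), no `Localization` API.  Over a field with `2 ≠ 0`, `m, n ≥ 2`; proof as printed
(for each generator of `P`, a product `s` of two variables off `P` with `s x ∈ P₂(M)` by
Lemma 2.1; the set of such `x` is an ideal since `P` is prime).
[cite: LaubenbacherSwanson2000, Prop. 5.1 (arXiv text p0007 L11–49)] -/
theorem prop_5_1 (h2 : (2 : F) ≠ 0) (hm : 2 ≤ m) (hn : 2 ≤ n)
    {P : Ideal (MvPolynomial (Fin m × Fin n) F)} (hP : P ∈ (subpermIdeal F m n 2).minimalPrimes)
    {x : MvPolynomial (Fin m × Fin n) F} (hx : x ∈ P) :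
    ∃ s ∉ P, s * x ∈ subpermIdeal F m n 2 := by
  classical
  have hPp : P.IsPrime := hP.1.1
  have h1P : (1 : MvPolynomial (Fin m × Fin n) F) ∉ P := (Ideal.ne_top_iff_one P).1 hPp.ne_top
  have h2u : IsUnit (2 : F) := h2.isUnit
  -- it suffices to treat generators
  have key : ∀ S : Set (MvPolynomial (Fin m × Fin n) F), P = Ideal.span S →
      (∀ g ∈ S, ∃ s ∉ P, s * g ∈ subpermIdeal F m n 2) →
      ∃ s ∉ P, s * x ∈ subpermIdeal F m n 2 := by
    intro S hS hgen
    have hx' : x ∈ Ideal.span S := hS ▸ hx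
    refine Submodule.span_induction ?_ ?_ ?_ ?_ hx'
    · exact hgen
    · exact ⟨1, h1P, by rw [mul_zero]; exact Ideal.zero_mem _⟩
    · rintro y z - - ⟨s, hs, hsy⟩ ⟨t, ht, htz⟩
      refine ⟨s * t, fun h => (hPp.mem_or_mem h).elim hs ht, ?_⟩
      have e : s * t * (y + z) = t * (s * y) + s * (t * z) := by ring
      rw [e]
      exact Ideal.add_mem _ (Ideal.mul_mem_left _ _ hsy) (Ideal.mul_mem_left _ _ htz)
    · rintro r y - ⟨s, hs, hsy⟩
      refine ⟨s, hs, ?_⟩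
      rw [smul_eq_mul, mul_left_comm]
      exact Ideal.mul_mem_left _ _ hsy
  rcases (thm_4_1 F h2 hm hn P).1 hP with ⟨hn3, r, rfl⟩ | ⟨hm3, c, rfl⟩ | ⟨r, s, c, d, hrs, hcd, rfl⟩
  · -- type (1): `x_{ij}` with `i ≠ r`; `s = x_{rp} x_{rq}`, `p ≠ q` off the column `j`
    refine key _ rfl ?_
    rintro g ⟨y, hy, rfl⟩
    obtain ⟨p, q, hpq, hp, hq⟩ := exists_ne_ne_of_three_le' hn3 y.2
    have hnot : ∀ t : Fin n, (X (r, t) : MvPolynomial (Fin m × Fin n) F) ∉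
        Ideal.span ((fun x => (X x : MvPolynomial (Fin m × Fin n) F)) '' {x | x.1 ≠ r}) := by
      intro t ht
      obtain ⟨z, hz, hzt⟩ := mem_ideal_span_X_image.1 ht (Finsupp.single (r, t) 1)
        (by rw [support_X]; exact Finset.mem_singleton_self _)
      rw [Finsupp.single_apply] at hzt
      split_ifs at hzt with hz'
      · exact hz (by rw [← hz'])
      · exact hzt rfl
    refine ⟨X (r, p) * X (r, q), fun h => ((isPrime_span_X_image _).mem_or_mem h).elim
      (hnot p) (hnot q), ?_⟩
    have hmem := lemma_2_1_rows h2u (fun e => hy e.symm) hpq hp hq (F := F)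
    obtain ⟨y₁, y₂⟩ := y
    exact hmem
  · -- type (2): the transposed argument
    refine key _ rfl ?_
    rintro g ⟨y, hy, rfl⟩
    obtain ⟨p, q, hpq, hp, hq⟩ := exists_ne_ne_of_three_le' hm3 y.1
    have hnot : ∀ t : Fin m, (X (t, c) : MvPolynomial (Fin m × Fin n) F) ∉
        Ideal.span ((fun x => (X x : MvPolynomial (Fin m × Fin n) F)) '' {x | x.2 ≠ c}) := by
      intro t ht
      obtain ⟨z, hz, hzt⟩ := mem_ideal_span_X_image.1 ht (Finsupp.single (t, c) 1)
        (by rw [support_X]; exact Finset.mem_singleton_self _)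
      rw [Finsupp.single_apply] at hzt
      split_ifs at hzt with hz'
      · exact hz (by rw [← hz'])
      · exact hzt rfl
    refine ⟨X (p, c) * X (q, c), fun h => ((isPrime_span_X_image _).mem_or_mem h).elim
      (hnot p) (hnot q), ?_⟩
    have hmem := lemma_2_1_cols h2u hpq hp hq (fun e => hy e.symm) (F := F)
    obtain ⟨y₁, y₂⟩ := y
    exact hmem
  · -- type (3): the block permanent is in `P₂(M)`; an off-block variable is multiplied by two
    -- block variables in one row (resp. one column) off its column (resp. row)
    refine key _ rfl ?_
    have hX := fun (z : Fin m × Fin n) (hz : (z.1 = r ∨ z.1 = s) ∧ (z.2 = c ∨ z.2 = d)) =>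
      X_notMem_blockIdeal (F := F) hrs hcd hz
    have hprime := isPrime_blockIdeal (F := F) hrs hcd
    rintro g (rfl | ⟨y, hy, rfl⟩)
    · exact ⟨1, h1P, by rw [one_mul]; exact pair_mem_subpermIdeal_two F hrs hcd⟩
    · by_cases hrow : y.1 = r ∨ y.1 = s
      · have hcol : ¬(y.2 = c ∨ y.2 = d) := fun h => hy ⟨hrow, h⟩
        -- the other row `r'` of the block
        obtain ⟨r', hr', hr'y⟩ : ∃ r' : Fin m, (r' = r ∨ r' = s) ∧ r' ≠ y.1 := by
          rcases hrow with h | h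
          · exact ⟨s, Or.inr rfl, fun e => hrs (h.symm ▸ e).symm⟩
          · exact ⟨r, Or.inl rfl, fun e => hrs (e.trans h)⟩
        refine ⟨X (r', c) * X (r', d), fun h => (hprime.mem_or_mem h).elim
          (hX (r', c) ⟨hr', Or.inl rfl⟩) (hX (r', d) ⟨hr', Or.inr rfl⟩), ?_⟩
        have hmem := lemma_2_1_rows h2u hr'y hcd (fun e => hcol (Or.inl e.symm))
          (fun e => hcol (Or.inr e.symm)) (F := F)
        obtain ⟨y₁, y₂⟩ := y
        exact hmem
      · have hyr : y.1 ≠ r := fun e => hrow (Or.inl e)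
        have hys : y.1 ≠ s := fun e => hrow (Or.inr e)
        -- a column `c'` of the block off the column of `y`
        obtain ⟨c', hc', hc'y⟩ : ∃ c' : Fin n, (c' = c ∨ c' = d) ∧ c' ≠ y.2 := by
          by_cases h : y.2 = c
          · exact ⟨d, Or.inr rfl, fun e => hcd (h.symm ▸ e).symm⟩
          · exact ⟨c, Or.inl rfl, fun e => h e.symm⟩
        refine ⟨X (r, c') * X (s, c'), fun h => (hprime.mem_or_mem h).elim
          (hX (r, c') ⟨Or.inl rfl, hc'⟩) (hX (s, c') ⟨Or.inr rfl, hc'⟩), ?_⟩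
        have hmem := lemma_2_1_cols h2u hrs (fun e => hyr e.symm) (fun e => hys e.symm) hc'y
          (F := F)
        obtain ⟨y₁, y₂⟩ := y
        exact hmem

end Prop51

end LaubenbacherSwanson2000

end Literature.Computability.AlgebraicComplexity
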